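import Literature.Computability.AlgebraicComplexity.DDS21GradedFractions
import Mathlib.RingTheory.Localization.FractionRing
import Mathlib.Tactic.FieldSimp
import HarnessLib

/-!
# Dutta–Dwivedi–Saxena 2021, proof of Thm. 3.2: one DiDIL step on EXACT bloated terms
# (brick B4b: the `K`-side algebra of "Divide and Derive", eq. (3.2), with size and `Σ∧Σ` certificates)

Topic `Literature/Computability/AlgebraicComplexity`; cell `val-lit`, row X2-DDS21, brick **B4b** of
the `DDS2021_thm_3_2` programme (lead-np RULINGS (132)(a), (133)(d), (134)(a); plan of record
`HOME/np/MEMO-t21g12-DDS21-B4-DiDIL.md` §3). Source: P. Dutta, P. Dwivedi, N. Saxena, *Demystifying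
the border of depth-3 algebraic circuits*, FOCS 2021 [DuttaDwivediSaxena2022], held full version
`paper:galaxy-pdf-7641649743695546420` (chunk `pNNNN.txt`, printed line `Lnnn`): the DiDIL induction
of §3, hypotheses (1)–(3) p0030 L799–805, "Divide and Derive" eq. (3.2) p0030 L808–812, the new
terms `T_{i,j+1} := (T_{i,j}/T̃_{k-j,j})·dlog(T_{i,j}/T̃_{k-j,j})` p0031 L815–817, "Invertibility of
`ΠΣ`-circuits" p0031 L836–845, Claim 3.6 (size blow-up) p0032 L848–850 with eq. (3.3) p0032
L854–862 and the linearisation `dlog(ΠΣ/ΠΣ) ∈ Σ dlog(Σ)` p0033 L873–887.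

## Frame (RULING (132)(a): R0 graded `x`-frame + R1 exact objects; the `ε`-side is brick B4c)

Everything here is over an arbitrary field `K` (in the programme `K = F(ε)`), in the rational
function field `K(x) = FractionRing (MvPolynomial (Fin n) K)`, and generic in a DERIVATION PAIR:
`E₀` a `K`-derivation of `K[x]` and `D` a `K`-derivation of `K(x)` extending it (`ExtendsDer`); the
instance of record is the Euler operator `euler (Fin n) K` / `eulerFrac` of
`DDS21GradedFractions.lean` (brick B4a), which is DDS's `z∂_z` read through the degree-tagging map
`Φ : x_i ↦ z x_i` (bridge file `DDS21PhiGradingBridge.lean`). The printed objects and ours: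

* a term of the bloated class, "`T_{i,j} = (U_{i,j}/V_{i,j})·(P_{i,j}/Q_{i,j})`, `U, V ∈ ΠΣ`,
  `P, Q ∈ Σ∧Σ`" (p0030 L801–803), is an `ExactTerm`: a `ΠΣ`-RATIO `A = κ·∏ℓ/∏ℓ'` of affine forms
  with NONZERO CONSTANT TERMS (hypothesis (3), "`U_{i,j}|_{z=0} ∈ F(ε)∖{0}`", p0030 L805) — data
  `PiRatio` = scalar + two lists of coefficient vectors `Option (Fin n) → K` — times a quotient
  `𝒫/𝒬` of two FRACTIONS `p/∏ℓ` (`FracPair`: a numerator polynomial over a product of such forms).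
  The `Σ∧Σ`-ness of `P, Q` "over `R_j = F[z]/(z^{d_j})`" is carried as a CERTIFICATE on graded pieces
  (`FracPair.Cert N t`: every degree-`c < N` piece `gcomp p (∏ℓ) c` of the power series `p/∏ℓ` is in
  `swsClass K n t c`), which is what eq. (3.3) produces and what Lemma 2.12/2.15 propagate;
* EXACT objects (R1): no truncation "mod `z^{d}`" is performed — `T ↦ E(T/T_{i₀})` is computed on the
  nose in `K(x)` (`ExactTerm.didil`, quotient rule), and eq. (3.2) becomes the exact identity
  `Σ_{i ≠ i₀} E(T_i/T_{i₀}) = E((Σ_i T_i)/T_{i₀})` (`sum_val_didilStep`; the divisor's own quotient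
  is `1` and dies under `E`). DISCLOSED DEVIATIONS from the letter of the print: (i) `E = z∂_z`
  replaces `∂_z` (valuations shift by one, same information — RULING (132)(a)); (ii) the print
  truncates the geometric series (3.3) inside the objects, we keep exact fractions and certify their
  pieces (MEMO-t21g12 F3: the truncated objects leave the `ε`-valuation ring); (iii) the divisor is
  ANY index `i₀` whose term is nondegenerate (`ND`), not the minimal-valuation one (vacuous for a
  generic shift, MEMO F6 / NOTE-t21g13 §2); (iv) the print divides by the `ε`-normalised `T̃ = ε^{-a}T`;
  here one divides by `T` and the `ε`-side (B4c) rescales with `ExactTerm.smul`.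

## Contents (definitions with bodies + proved API; 0 named facts)

* §1 affine-form data `affForm`, `linPart`, `formProd` (+ constant terms, degrees, `euler_affForm`);
* §2 `FracPair` (`val`, `ofPoly`, `mul`, `add`, `neg`, `sub`, `smul`, `der E₀` with `val_*`);
  `ExtendsDer`; §3 `PiRatio` (`val`, `val_ne_zero`, `div`, `dlog E₀` with `val_dlog = D val / val`);
* §4 `ExactTerm` (`val`, `WF`, `ND`, `ofForms` (stage `0`), `smul`, `divT`, `derT`, ★`didil`,
  `numPoly`/`denPoly`), the step `didilStep` on `Fin (m+1)`-families and ★`sum_val_didilStep`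
  (eq. (3.2) exact) with its Euler instance `sum_val_didilStep_euler`;
* §5 sizes (Claim 3.6's degree/size recursion in shape form): `Bdd B` (all form lists `≤ B`,
  numerator degrees `≤ B`) with `bdd_divT (2B)`, `bdd_derT (10B)`, `bdd_didil (20B)` for any
  degree-non-raising `E₀` (`DegLE`, `degLE_euler`);
* §6 certificates: `FracPair.Cert`, `PiRatio.cert_dlog` (eq. (3.3) summed over the forms, via
  `gcomp_linear_affine` of B4a), `ExactTerm.Cert N t` with ★`Cert.divT (N²t²)`, ★`Cert.derT
  ((2B+2)N⁴t²)`, ★`Cert.didil ((4B+2)N⁸t⁴)`, `cert_didilStep`; the convolution budget lemma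
  `sum_antidiagonal_mul_mem_swsClass`;
* §7 (v2) iteration under a divisor-choice rule: `Choice`, `didilIter E₀ c m j` (`j` rounds,
  `Fin (m+j) → Fin m`), `DivisorsND`, `wf_didilIter`, `bdd_didilIter` (`20^j·B`), `certTower` /
  `cert_didilIter`, `sum_val_didilIter_succ`; stage `0`: `LiveTerm`, `ofLiveTerm`,
  ★`exists_stageZero` (the live products of a `Σ^{[k]}Π^{[d]}Σ` circuit as exact terms).
* §8 (v3) provenance of forms (asked by the end game, val-lit t19 g12): `ExactTerm.FormsSat P T`
  ("all forms in `A.num`, `A.den`, `𝒫.L`, `𝒬.L` satisfy `P`"), the projection lemmas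
  `divT_A_num/_A_den/_P_L/_Q_L`, `derT_A/_P_L/_Q_L`, closure `FormsSat.smul/divT/derT/didil`,
  `formsSat_didilStep`, `formsSat_didilIter`, `formsSat_ofForms/ofLiveTerm`, and
  ★`exists_stageZero_forall` (stage `0` with the record that every form of every term is one of the
  input forms `α i j`); (v4) `exists_stageZero_ofLiveTerm` (the same + the SHAPE record
  `G i = ofLiveTerm (α i') h`, asked by the E4.4 companion, val-lit t21 g13).
* §9 (v5) the uniform-`𝒬` invariant (RULING (167)(a)(1), slice-zero programs): accessors
  `divT_Q/_P`, `derT_Q`, `didil_Q`, `didilStep_Q`, `ofForms_P/_Q`, `ofLiveTerm_P/_Q`, and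
  `didilStep_Q_eq`, `didilIter_Q_eq`, `Q_eq_of_ofLiveTerm`, `didilIter_Q_eq_of_ofLiveTerm`.

What is NOT here: the `ε`-bookkeeping (`IsEpsInt`/`EpsLim`, bricks B4c (E1)–(E4):
`DDS21EpsIntegralFractions.lean` and successors), the generic shift, the trace-back (B5), the
exponent tower in closed form and the final assembly (their own files). Honest framing: algebra
plumbing for one brick of a published 2021 upper bound; `DDS2021_thm_3_2` / `DDS2021_thm_5_1` remain
named facts (OPEN by name); nothing here bears on VP versus VNP, which is NOT proved.

## References

* [DuttaDwivediSaxena2022] P. Dutta, P. Dwivedi, N. Saxena, *Demystifying the border of depth-3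
  algebraic circuits*, Proc. 62nd FOCS (2021), IEEE 2022, 92–103; full version
  `paper:galaxy-pdf-7641649743695546420`: §3 proof of Thm. 3.2, p0030 L799–812, p0031 L815–845,
  p0032 L848–862, p0033 L873–887; Lemma 2.12 p0020 L549–555; Lemma 2.15 p0021 L578–583.
-/

noncomputable section

open MvPolynomial
open Finset.HasAntidiagonal (antidiagonal mem_antidiagonal)
open scoped BigOperators

namespace Literature.Computability.AlgebraicComplexity

namespace DDS2021

variable {K : Type*} [Field K] {n : ℕ}

/-! ### Affine forms as data -/

/-- The affine form `a_∅ + Σ_m a_m x_m` with coefficient data `a : Option (Fin n) → K`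
(the convention of `swsClass` / `MS2021.IsSPS`).
[cite: DuttaDwivediSaxena2022, Def. 3.1 and §2.3 (`ΠΣ` = products of affine forms, `Σ∧Σ`), full version p0026 L702–707, p0020 L537–540] -/
def affForm (a : Option (Fin n) → K) : MvPolynomial (Fin n) K :=
  C (a none) + ∑ m, C (a (some m)) * X m

/-- The linear part `Σ_m a_m x_m` of the affine form `affForm a`.
[cite: DuttaDwivediSaxena2022, Def. 3.1 and §2.3 (`ΠΣ` = products of affine forms, `Σ∧Σ`), full version p0026 L702–707, p0020 L537–540] -/
def linPart (a : Option (Fin n) → K) : MvPolynomial (Fin n) K :=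
  ∑ m, C (a (some m)) * X m

/-- `affForm_eq` (API of the exact DiDIL objects). [cite: DuttaDwivediSaxena2022, Def. 3.1 and §2.3 (`ΠΣ` = products of affine forms, `Σ∧Σ`), full version p0026 L702–707, p0020 L537–540] -/
theorem affForm_eq (a : Option (Fin n) → K) : affForm a = C (a none) + linPart a := rfl

/-- `coeff_zero_linPart` (API of the exact DiDIL objects). [cite: DuttaDwivediSaxena2022, Def. 3.1 and §2.3 (`ΠΣ` = products of affine forms, `Σ∧Σ`), full version p0026 L702–707, p0020 L537–540] -/
theorem coeff_zero_linPart (a : Option (Fin n) → K) : coeff 0 (linPart a) = 0 := by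
  classical
  simp only [linPart, coeff_sum, coeff_C_mul, coeff_zero_X, mul_zero, Finset.sum_const_zero]

/-- `coeff_zero_affForm` (API of the exact DiDIL objects). [cite: DuttaDwivediSaxena2022, Def. 3.1 and §2.3 (`ΠΣ` = products of affine forms, `Σ∧Σ`), full version p0026 L702–707, p0020 L537–540] -/
theorem coeff_zero_affForm (a : Option (Fin n) → K) : coeff 0 (affForm a) = a none := by
  classical
  rw [affForm_eq, coeff_add, coeff_zero_C, coeff_zero_linPart, add_zero]

/-- `affForm_ne_zero` (API of the exact DiDIL objects). [cite: DuttaDwivediSaxena2022, Def. 3.1 and §2.3 (`ΠΣ` = products of affine forms, `Σ∧Σ`), full version p0026 L702–707, p0020 L537–540] -/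
theorem affForm_ne_zero {a : Option (Fin n) → K} (ha : a none ≠ 0) : affForm a ≠ 0 := by
  intro h
  apply ha
  rw [← coeff_zero_affForm a, h, coeff_zero]

/-- Product of the affine forms of a list of coefficient data.
[cite: DuttaDwivediSaxena2022, Def. 3.1 and §2.3 (`ΠΣ` = products of affine forms, `Σ∧Σ`), full version p0026 L702–707, p0020 L537–540] -/
def formProd (L : List (Option (Fin n) → K)) : MvPolynomial (Fin n) K :=
  (L.map affForm).prod

/-- `formProd_nil` (API of the exact DiDIL objects). [cite: DuttaDwivediSaxena2022, Def. 3.1 and §2.3 (`ΠΣ` = products of affine forms, `Σ∧Σ`), full version p0026 L702–707, p0020 L537–540] -/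
@[simp] theorem formProd_nil : formProd ([] : List (Option (Fin n) → K)) = 1 := by
  simp [formProd]

/-- `formProd_cons` (API of the exact DiDIL objects). [cite: DuttaDwivediSaxena2022, Def. 3.1 and §2.3 (`ΠΣ` = products of affine forms, `Σ∧Σ`), full version p0026 L702–707, p0020 L537–540] -/
@[simp] theorem formProd_cons (a : Option (Fin n) → K) (L : List (Option (Fin n) → K)) :
    formProd (a :: L) = affForm a * formProd L := by
  simp [formProd]

/-- `formProd_append` (API of the exact DiDIL objects). [cite: DuttaDwivediSaxena2022, Def. 3.1 and §2.3 (`ΠΣ` = products of affine forms, `Σ∧Σ`), full version p0026 L702–707, p0020 L537–540] -/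
@[simp] theorem formProd_append (L₁ L₂ : List (Option (Fin n) → K)) :
    formProd (L₁ ++ L₂) = formProd L₁ * formProd L₂ := by
  simp [formProd, List.map_append, List.prod_append]

/-- `formProd_ne_zero` (API of the exact DiDIL objects). [cite: DuttaDwivediSaxena2022, Def. 3.1 and §2.3 (`ΠΣ` = products of affine forms, `Σ∧Σ`), full version p0026 L702–707, p0020 L537–540] -/
theorem formProd_ne_zero {L : List (Option (Fin n) → K)} (hL : ∀ a ∈ L, a none ≠ 0) :
    formProd L ≠ 0 := by
  induction L with
  | nil => simp
  | cons a L ih =>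
    rw [formProd_cons]
    exact mul_ne_zero (affForm_ne_zero (hL a (by simp)))
      (ih fun b hb => hL b (by simp [hb]))

/-- A `ΠΣ` product given by indexed data: `formProd (List.ofFn g) = ∏_j affForm (g j)` (the terms
`∏_{j∈[d]} ℓ_{ij}` of a `Σ^{[k]}Π^{[d]}Σ` circuit, `MS2021.IsSPS` data).
[cite: DuttaDwivediSaxena2022, Def. 3.1 and §2.3 (`ΠΣ` = products of affine forms, `Σ∧Σ`), full version p0026 L702–707, p0020 L537–540] -/
theorem formProd_ofFn {d : ℕ} (g : Fin d → Option (Fin n) → K) :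
    formProd (List.ofFn g) = ∏ j, affForm (g j) := by
  rw [formProd, List.map_ofFn, List.prod_ofFn]
  rfl


/-! ### Fractions `p / Π` with `Π` a product of invertible affine forms -/

variable (K n) in
/-- A fraction `p / ∏_{a ∈ L} affForm a` of the rational function field `K(x)`, given by a
numerator polynomial `p` and a list `L` of affine forms with nonzero constant terms.
[cite: DuttaDwivediSaxena2022, §3 proof of Thm. 3.2, the terms `(U/V)·(P/Q)` of the DiDIL induction and Claim 3.6 (full version p0030 L801–805, p0031 L836–845, p0032 L848–850)] -/
structure FracPair where
  /-- numerator -/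
  p : MvPolynomial (Fin n) K
  /-- the denominator, as a list of affine-form data -/
  L : List (Option (Fin n) → K)
  /-- every listed form has a nonzero constant term -/
  hL : ∀ a ∈ L, a none ≠ 0

namespace FracPair

/-- The denominator polynomial `∏_{a ∈ L} affForm a`.
[cite: DuttaDwivediSaxena2022, §3 proof of Thm. 3.2, the terms `(U/V)·(P/Q)` of the DiDIL induction and Claim 3.6 (full version p0030 L801–805, p0031 L836–845, p0032 L848–850)] -/
def den (P : FracPair K n) : MvPolynomial (Fin n) K := formProd P.L

/-- `den_ne_zero` (API of the exact DiDIL objects). [cite: DuttaDwivediSaxena2022, §3 proof of Thm. 3.2, the terms `(U/V)·(P/Q)` of the DiDIL induction and Claim 3.6 (full version p0030 L801–805, p0031 L836–845, p0032 L848–850)] -/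
theorem den_ne_zero (P : FracPair K n) : P.den ≠ 0 := formProd_ne_zero P.hL

/-- The value `p / den` in the fraction field `K(x)`.
[cite: DuttaDwivediSaxena2022, §3 proof of Thm. 3.2, the terms `(U/V)·(P/Q)` of the DiDIL induction and Claim 3.6 (full version p0030 L801–805, p0031 L836–845, p0032 L848–850)] -/
def val (P : FracPair K n) : FractionRing (MvPolynomial (Fin n) K) :=
  algebraMap (MvPolynomial (Fin n) K) (FractionRing (MvPolynomial (Fin n) K)) P.p /
    algebraMap (MvPolynomial (Fin n) K) (FractionRing (MvPolynomial (Fin n) K)) P.den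

/-- `algebraMap_den_ne_zero` (API of the exact DiDIL objects). [cite: DuttaDwivediSaxena2022, §3 proof of Thm. 3.2, the terms `(U/V)·(P/Q)` of the DiDIL induction and Claim 3.6 (full version p0030 L801–805, p0031 L836–845, p0032 L848–850)] -/
theorem algebraMap_den_ne_zero (P : FracPair K n) :
    algebraMap (MvPolynomial (Fin n) K) (FractionRing (MvPolynomial (Fin n) K)) P.den ≠ 0 :=
  fun h => P.den_ne_zero ((IsFractionRing.injective _ _) (by rw [h, map_zero]))

/-- The polynomial `p` as a fraction `p / 1`.
[cite: DuttaDwivediSaxena2022, §3 proof of Thm. 3.2, the terms `(U/V)·(P/Q)` of the DiDIL induction and Claim 3.6 (full version p0030 L801–805, p0031 L836–845, p0032 L848–850)] -/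
def ofPoly (p : MvPolynomial (Fin n) K) : FracPair K n := ⟨p, [], by simp⟩

/-- `ofPoly_p` (API of the exact DiDIL objects). [cite: DuttaDwivediSaxena2022, §3 proof of Thm. 3.2, the terms `(U/V)·(P/Q)` of the DiDIL induction and Claim 3.6 (full version p0030 L801–805, p0031 L836–845, p0032 L848–850)] -/
@[simp] theorem ofPoly_p (p : MvPolynomial (Fin n) K) : (ofPoly p).p = p := rfl
/-- `ofPoly_L` (API of the exact DiDIL objects). [cite: DuttaDwivediSaxena2022, §3 proof of Thm. 3.2, the terms `(U/V)·(P/Q)` of the DiDIL induction and Claim 3.6 (full version p0030 L801–805, p0031 L836–845, p0032 L848–850)] -/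
@[simp] theorem ofPoly_L (p : MvPolynomial (Fin n) K) : (ofPoly p).L = [] := rfl

/-- `den_ofPoly` (API of the exact DiDIL objects). [cite: DuttaDwivediSaxena2022, §3 proof of Thm. 3.2, the terms `(U/V)·(P/Q)` of the DiDIL induction and Claim 3.6 (full version p0030 L801–805, p0031 L836–845, p0032 L848–850)] -/
theorem den_ofPoly (p : MvPolynomial (Fin n) K) : (ofPoly p).den = 1 := by simp [den, ofPoly]

/-- `val_ofPoly` (API of the exact DiDIL objects). [cite: DuttaDwivediSaxena2022, §3 proof of Thm. 3.2, the terms `(U/V)·(P/Q)` of the DiDIL induction and Claim 3.6 (full version p0030 L801–805, p0031 L836–845, p0032 L848–850)] -/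
theorem val_ofPoly (p : MvPolynomial (Fin n) K) :
    (ofPoly p).val = algebraMap (MvPolynomial (Fin n) K) (FractionRing (MvPolynomial (Fin n) K)) p := by
  rw [val, den_ofPoly, map_one, div_one, ofPoly_p]

/-- Product of two fractions: numerators multiply, form lists concatenate.
[cite: DuttaDwivediSaxena2022, §3 proof of Thm. 3.2, the terms `(U/V)·(P/Q)` of the DiDIL induction and Claim 3.6 (full version p0030 L801–805, p0031 L836–845, p0032 L848–850)] -/
def mul (P Q : FracPair K n) : FracPair K n :=
  ⟨P.p * Q.p, P.L ++ Q.L, fun a ha => by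
    rcases List.mem_append.1 ha with h | h
    · exact P.hL a h
    · exact Q.hL a h⟩

/-- `mul_p` (API of the exact DiDIL objects). [cite: DuttaDwivediSaxena2022, §3 proof of Thm. 3.2, the terms `(U/V)·(P/Q)` of the DiDIL induction and Claim 3.6 (full version p0030 L801–805, p0031 L836–845, p0032 L848–850)] -/
@[simp] theorem mul_p (P Q : FracPair K n) : (P.mul Q).p = P.p * Q.p := rfl
/-- `mul_L` (API of the exact DiDIL objects). [cite: DuttaDwivediSaxena2022, §3 proof of Thm. 3.2, the terms `(U/V)·(P/Q)` of the DiDIL induction and Claim 3.6 (full version p0030 L801–805, p0031 L836–845, p0032 L848–850)] -/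
@[simp] theorem mul_L (P Q : FracPair K n) : (P.mul Q).L = P.L ++ Q.L := rfl

/-- `den_mul` (API of the exact DiDIL objects). [cite: DuttaDwivediSaxena2022, §3 proof of Thm. 3.2, the terms `(U/V)·(P/Q)` of the DiDIL induction and Claim 3.6 (full version p0030 L801–805, p0031 L836–845, p0032 L848–850)] -/
theorem den_mul (P Q : FracPair K n) : (P.mul Q).den = P.den * Q.den := by
  simp [den, mul]

/-- `val_mul` (API of the exact DiDIL objects). [cite: DuttaDwivediSaxena2022, §3 proof of Thm. 3.2, the terms `(U/V)·(P/Q)` of the DiDIL induction and Claim 3.6 (full version p0030 L801–805, p0031 L836–845, p0032 L848–850)] -/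
theorem val_mul (P Q : FracPair K n) : (P.mul Q).val = P.val * Q.val := by
  rw [val, val, val, mul_p, den_mul, map_mul, map_mul, div_mul_div_comm]

/-- Sum of two fractions over the concatenated form list.
[cite: DuttaDwivediSaxena2022, §3 proof of Thm. 3.2, the terms `(U/V)·(P/Q)` of the DiDIL induction and Claim 3.6 (full version p0030 L801–805, p0031 L836–845, p0032 L848–850)] -/
def add (P Q : FracPair K n) : FracPair K n :=
  ⟨P.p * Q.den + Q.p * P.den, P.L ++ Q.L, fun a ha => by
    rcases List.mem_append.1 ha with h | h
    · exact P.hL a h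
    · exact Q.hL a h⟩

/-- `add_p` (API of the exact DiDIL objects). [cite: DuttaDwivediSaxena2022, §3 proof of Thm. 3.2, the terms `(U/V)·(P/Q)` of the DiDIL induction and Claim 3.6 (full version p0030 L801–805, p0031 L836–845, p0032 L848–850)] -/
@[simp] theorem add_p (P Q : FracPair K n) : (P.add Q).p = P.p * Q.den + Q.p * P.den := rfl
/-- `add_L` (API of the exact DiDIL objects). [cite: DuttaDwivediSaxena2022, §3 proof of Thm. 3.2, the terms `(U/V)·(P/Q)` of the DiDIL induction and Claim 3.6 (full version p0030 L801–805, p0031 L836–845, p0032 L848–850)] -/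
@[simp] theorem add_L (P Q : FracPair K n) : (P.add Q).L = P.L ++ Q.L := rfl

/-- `den_add` (API of the exact DiDIL objects). [cite: DuttaDwivediSaxena2022, §3 proof of Thm. 3.2, the terms `(U/V)·(P/Q)` of the DiDIL induction and Claim 3.6 (full version p0030 L801–805, p0031 L836–845, p0032 L848–850)] -/
theorem den_add (P Q : FracPair K n) : (P.add Q).den = P.den * Q.den := by
  simp [den, add]

/-- `val_add` (API of the exact DiDIL objects). [cite: DuttaDwivediSaxena2022, §3 proof of Thm. 3.2, the terms `(U/V)·(P/Q)` of the DiDIL induction and Claim 3.6 (full version p0030 L801–805, p0031 L836–845, p0032 L848–850)] -/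
theorem val_add (P Q : FracPair K n) : (P.add Q).val = P.val + Q.val := by
  rw [val, val, val, add_p, den_add, map_add, map_mul, map_mul, map_mul,
    div_add_div _ _ P.algebraMap_den_ne_zero Q.algebraMap_den_ne_zero]
  ring

/-- Scalar multiple `c · (p/Π) = (c p)/Π`.
[cite: DuttaDwivediSaxena2022, §3 proof of Thm. 3.2, the terms `(U/V)·(P/Q)` of the DiDIL induction and Claim 3.6 (full version p0030 L801–805, p0031 L836–845, p0032 L848–850)] -/
def smul (c : K) (P : FracPair K n) : FracPair K n := ⟨C c * P.p, P.L, P.hL⟩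

/-- `smul_p` (API of the exact DiDIL objects). [cite: DuttaDwivediSaxena2022, §3 proof of Thm. 3.2, the terms `(U/V)·(P/Q)` of the DiDIL induction and Claim 3.6 (full version p0030 L801–805, p0031 L836–845, p0032 L848–850)] -/
@[simp] theorem smul_p (c : K) (P : FracPair K n) : (P.smul c).p = C c * P.p := rfl
/-- `smul_L` (API of the exact DiDIL objects). [cite: DuttaDwivediSaxena2022, §3 proof of Thm. 3.2, the terms `(U/V)·(P/Q)` of the DiDIL induction and Claim 3.6 (full version p0030 L801–805, p0031 L836–845, p0032 L848–850)] -/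
@[simp] theorem smul_L (c : K) (P : FracPair K n) : (P.smul c).L = P.L := rfl

/-- `den_smul` (API of the exact DiDIL objects). [cite: DuttaDwivediSaxena2022, §3 proof of Thm. 3.2, the terms `(U/V)·(P/Q)` of the DiDIL induction and Claim 3.6 (full version p0030 L801–805, p0031 L836–845, p0032 L848–850)] -/
theorem den_smul (c : K) (P : FracPair K n) : (P.smul c).den = P.den := rfl

/-- `val_smul` (API of the exact DiDIL objects). [cite: DuttaDwivediSaxena2022, §3 proof of Thm. 3.2, the terms `(U/V)·(P/Q)` of the DiDIL induction and Claim 3.6 (full version p0030 L801–805, p0031 L836–845, p0032 L848–850)] -/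
theorem val_smul (c : K) (P : FracPair K n) :
    (P.smul c).val =
      algebraMap (MvPolynomial (Fin n) K) (FractionRing (MvPolynomial (Fin n) K)) (C c) * P.val := by
  rw [val, val, smul_p, den_smul, map_mul, mul_div_assoc]

/-- Negation.
[cite: DuttaDwivediSaxena2022, §3 proof of Thm. 3.2, the terms `(U/V)·(P/Q)` of the DiDIL induction and Claim 3.6 (full version p0030 L801–805, p0031 L836–845, p0032 L848–850)] -/
def neg (P : FracPair K n) : FracPair K n := ⟨-P.p, P.L, P.hL⟩

/-- `neg_p` (API of the exact DiDIL objects). [cite: DuttaDwivediSaxena2022, §3 proof of Thm. 3.2, the terms `(U/V)·(P/Q)` of the DiDIL induction and Claim 3.6 (full version p0030 L801–805, p0031 L836–845, p0032 L848–850)] -/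
@[simp] theorem neg_p (P : FracPair K n) : P.neg.p = -P.p := rfl
/-- `neg_L` (API of the exact DiDIL objects). [cite: DuttaDwivediSaxena2022, §3 proof of Thm. 3.2, the terms `(U/V)·(P/Q)` of the DiDIL induction and Claim 3.6 (full version p0030 L801–805, p0031 L836–845, p0032 L848–850)] -/
@[simp] theorem neg_L (P : FracPair K n) : P.neg.L = P.L := rfl

/-- `den_neg` (API of the exact DiDIL objects). [cite: DuttaDwivediSaxena2022, §3 proof of Thm. 3.2, the terms `(U/V)·(P/Q)` of the DiDIL induction and Claim 3.6 (full version p0030 L801–805, p0031 L836–845, p0032 L848–850)] -/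
theorem den_neg (P : FracPair K n) : P.neg.den = P.den := rfl

/-- `val_neg` (API of the exact DiDIL objects). [cite: DuttaDwivediSaxena2022, §3 proof of Thm. 3.2, the terms `(U/V)·(P/Q)` of the DiDIL induction and Claim 3.6 (full version p0030 L801–805, p0031 L836–845, p0032 L848–850)] -/
theorem val_neg (P : FracPair K n) : P.neg.val = -P.val := by
  rw [val, val, neg_p, den_neg, map_neg, neg_div]

/-- Difference.
[cite: DuttaDwivediSaxena2022, §3 proof of Thm. 3.2, the terms `(U/V)·(P/Q)` of the DiDIL induction and Claim 3.6 (full version p0030 L801–805, p0031 L836–845, p0032 L848–850)] -/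
def sub (P Q : FracPair K n) : FracPair K n := P.add Q.neg

/-- `val_sub` (API of the exact DiDIL objects). [cite: DuttaDwivediSaxena2022, §3 proof of Thm. 3.2, the terms `(U/V)·(P/Q)` of the DiDIL induction and Claim 3.6 (full version p0030 L801–805, p0031 L836–845, p0032 L848–850)] -/
theorem val_sub (P Q : FracPair K n) : (P.sub Q).val = P.val - Q.val := by
  rw [sub, val_add, val_neg, sub_eq_add_neg]

/-- `sub_L` (API of the exact DiDIL objects). [cite: DuttaDwivediSaxena2022, §3 proof of Thm. 3.2, the terms `(U/V)·(P/Q)` of the DiDIL induction and Claim 3.6 (full version p0030 L801–805, p0031 L836–845, p0032 L848–850)] -/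
@[simp] theorem sub_L (P Q : FracPair K n) : (P.sub Q).L = P.L ++ Q.L := rfl

/-- `sub_p` (API of the exact DiDIL objects). [cite: DuttaDwivediSaxena2022, §3 proof of Thm. 3.2, the terms `(U/V)·(P/Q)` of the DiDIL induction and Claim 3.6 (full version p0030 L801–805, p0031 L836–845, p0032 L848–850)] -/
theorem sub_p (P Q : FracPair K n) : (P.sub Q).p = P.p * Q.den - Q.p * P.den := by
  simp [sub, add, neg, den, sub_eq_add_neg]

/-- The image of a fraction under a derivation `E₀` of `K[x]` (quotient rule):
`E(p/Π) = (E p · Π − p · E Π) / Π²`.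
[cite: DuttaDwivediSaxena2022, §3 proof of Thm. 3.2, Divide and Derive, eq. (3.2) and `T_{i,j+1} := (T_{i,j}/T̃_{k-j,j})·dlog(T_{i,j}/T̃_{k-j,j})` (full version p0030 L808–812, p0031 L815–817)] -/
def der (E₀ : Derivation K (MvPolynomial (Fin n) K) (MvPolynomial (Fin n) K)) (P : FracPair K n) :
    FracPair K n :=
  ⟨E₀ P.p * P.den - P.p * E₀ P.den, P.L ++ P.L, fun a ha => by
    rcases List.mem_append.1 ha with h | h
    · exact P.hL a h
    · exact P.hL a h⟩

/-- `der_p` (API of the exact DiDIL objects). [cite: DuttaDwivediSaxena2022, §3 proof of Thm. 3.2, Divide and Derive, eq. (3.2) and `T_{i,j+1} := (T_{i,j}/T̃_{k-j,j})·dlog(T_{i,j}/T̃_{k-j,j})` (full version p0030 L808–812, p0031 L815–817)] -/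
@[simp] theorem der_p (E₀ : Derivation K (MvPolynomial (Fin n) K) (MvPolynomial (Fin n) K))
    (P : FracPair K n) : (P.der E₀).p = E₀ P.p * P.den - P.p * E₀ P.den := rfl
/-- `der_L` (API of the exact DiDIL objects). [cite: DuttaDwivediSaxena2022, §3 proof of Thm. 3.2, Divide and Derive, eq. (3.2) and `T_{i,j+1} := (T_{i,j}/T̃_{k-j,j})·dlog(T_{i,j}/T̃_{k-j,j})` (full version p0030 L808–812, p0031 L815–817)] -/
@[simp] theorem der_L (E₀ : Derivation K (MvPolynomial (Fin n) K) (MvPolynomial (Fin n) K))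
    (P : FracPair K n) : (P.der E₀).L = P.L ++ P.L := rfl

/-- `den_der` (API of the exact DiDIL objects). [cite: DuttaDwivediSaxena2022, §3 proof of Thm. 3.2, Divide and Derive, eq. (3.2) and `T_{i,j+1} := (T_{i,j}/T̃_{k-j,j})·dlog(T_{i,j}/T̃_{k-j,j})` (full version p0030 L808–812, p0031 L815–817)] -/
theorem den_der (E₀ : Derivation K (MvPolynomial (Fin n) K) (MvPolynomial (Fin n) K))
    (P : FracPair K n) : (P.der E₀).den = P.den * P.den := by
  simp [den, der]

end FracPair

/-! ### A derivation of `K(x)` extending a derivation of `K[x]` -/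

variable (K n) in
/-- `D` extends `E₀`: `D (p/1) = (E₀ p)/1` for every polynomial `p`.
[cite: DuttaDwivediSaxena2022, §3 proof of Thm. 3.2, Divide and Derive, eq. (3.2) and `T_{i,j+1} := (T_{i,j}/T̃_{k-j,j})·dlog(T_{i,j}/T̃_{k-j,j})` (full version p0030 L808–812, p0031 L815–817)] -/
def ExtendsDer (E₀ : Derivation K (MvPolynomial (Fin n) K) (MvPolynomial (Fin n) K))
    (D : Derivation K (FractionRing (MvPolynomial (Fin n) K))
      (FractionRing (MvPolynomial (Fin n) K))) : Prop :=
  ∀ p : MvPolynomial (Fin n) K,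
    D (algebraMap (MvPolynomial (Fin n) K) (FractionRing (MvPolynomial (Fin n) K)) p) =
      algebraMap (MvPolynomial (Fin n) K) (FractionRing (MvPolynomial (Fin n) K)) (E₀ p)

namespace FracPair

/-- `val_der` (API of the exact DiDIL objects). [cite: DuttaDwivediSaxena2022, §3 proof of Thm. 3.2, Divide and Derive, eq. (3.2) and `T_{i,j+1} := (T_{i,j}/T̃_{k-j,j})·dlog(T_{i,j}/T̃_{k-j,j})` (full version p0030 L808–812, p0031 L815–817)] -/
theorem val_der {E₀ : Derivation K (MvPolynomial (Fin n) K) (MvPolynomial (Fin n) K)}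
    {D : Derivation K (FractionRing (MvPolynomial (Fin n) K))
      (FractionRing (MvPolynomial (Fin n) K))}
    (hD : ExtendsDer K n E₀ D) (P : FracPair K n) : (P.der E₀).val = D P.val := by
  have hden := P.algebraMap_den_ne_zero
  rw [val, val, der_p, den_der, D.leibniz_div, map_sub, map_mul, map_mul, map_mul, ← hD, ← hD]
  simp only [smul_eq_mul]
  field_simp

end FracPair


/-! ### `ΠΣ`-ratios `κ · ∏ ℓ / ∏ ℓ'` of invertible affine forms -/

variable (K n) in
/-- A ratio `κ · (∏_{a ∈ num} affForm a) / (∏_{a ∈ den} affForm a)` of products of affine forms with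
nonzero constant terms, `κ ≠ 0` (the `U/V` part of a bloated term, with its scalar).
[cite: DuttaDwivediSaxena2022, §3 proof of Thm. 3.2, "Invertibility of `ΠΣ`-circuits", `U_{i,j+1} := ε^{-a}·U_{i,j}·V_{k-j,j}`, `V_{i,j+1} := V_{i,j}·U_{k-j,j}` (full version p0031 L836–845)] -/
structure PiRatio where
  /-- the scalar -/
  κ : K
  /-- numerator forms -/
  num : List (Option (Fin n) → K)
  /-- denominator forms -/
  den : List (Option (Fin n) → K)
  hκ : κ ≠ 0
  hnum : ∀ a ∈ num, a none ≠ 0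
  hden : ∀ a ∈ den, a none ≠ 0

namespace PiRatio

/-- The value `κ · ∏ num / ∏ den` in `K(x)`.
[cite: DuttaDwivediSaxena2022, §3 proof of Thm. 3.2, "Invertibility of `ΠΣ`-circuits", `U_{i,j+1} := ε^{-a}·U_{i,j}·V_{k-j,j}`, `V_{i,j+1} := V_{i,j}·U_{k-j,j}` (full version p0031 L836–845)] -/
def val (A : PiRatio K n) : FractionRing (MvPolynomial (Fin n) K) :=
  algebraMap (MvPolynomial (Fin n) K) (FractionRing (MvPolynomial (Fin n) K)) (C A.κ * formProd A.num) /
    algebraMap (MvPolynomial (Fin n) K) (FractionRing (MvPolynomial (Fin n) K)) (formProd A.den)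

/-- `algebraMap_num_ne_zero` (API of the exact DiDIL objects). [cite: DuttaDwivediSaxena2022, §3 proof of Thm. 3.2, "Invertibility of `ΠΣ`-circuits", `U_{i,j+1} := ε^{-a}·U_{i,j}·V_{k-j,j}`, `V_{i,j+1} := V_{i,j}·U_{k-j,j}` (full version p0031 L836–845)] -/
theorem algebraMap_num_ne_zero (A : PiRatio K n) :
    algebraMap (MvPolynomial (Fin n) K) (FractionRing (MvPolynomial (Fin n) K))
      (C A.κ * formProd A.num) ≠ 0 :=
  fun h => (mul_ne_zero (C_eq_zero.not.2 A.hκ) (formProd_ne_zero A.hnum))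
    ((IsFractionRing.injective _ _) (by rw [h, map_zero]))

/-- `algebraMap_den_ne_zero` (API of the exact DiDIL objects). [cite: DuttaDwivediSaxena2022, §3 proof of Thm. 3.2, "Invertibility of `ΠΣ`-circuits", `U_{i,j+1} := ε^{-a}·U_{i,j}·V_{k-j,j}`, `V_{i,j+1} := V_{i,j}·U_{k-j,j}` (full version p0031 L836–845)] -/
theorem algebraMap_den_ne_zero (A : PiRatio K n) :
    algebraMap (MvPolynomial (Fin n) K) (FractionRing (MvPolynomial (Fin n) K)) (formProd A.den) ≠ 0 :=
  fun h => (formProd_ne_zero A.hden) ((IsFractionRing.injective _ _) (by rw [h, map_zero]))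

/-- `val_ne_zero` (API of the exact DiDIL objects). [cite: DuttaDwivediSaxena2022, §3 proof of Thm. 3.2, "Invertibility of `ΠΣ`-circuits", `U_{i,j+1} := ε^{-a}·U_{i,j}·V_{k-j,j}`, `V_{i,j+1} := V_{i,j}·U_{k-j,j}` (full version p0031 L836–845)] -/
theorem val_ne_zero (A : PiRatio K n) : A.val ≠ 0 :=
  div_ne_zero A.algebraMap_num_ne_zero A.algebraMap_den_ne_zero

/-- Quotient of two `ΠΣ`-ratios (the `U_{i,j+1}/V_{i,j+1}` of the DiDIL step: numerator lists and
denominator lists are concatenated crosswise, scalars divide).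
[cite: DuttaDwivediSaxena2022, §3 proof of Thm. 3.2, "Invertibility of `ΠΣ`-circuits", `U_{i,j+1} := ε^{-a}·U_{i,j}·V_{k-j,j}`, `V_{i,j+1} := V_{i,j}·U_{k-j,j}` (full version p0031 L836–845)] -/
def div (A B : PiRatio K n) : PiRatio K n where
  κ := A.κ / B.κ
  num := A.num ++ B.den
  den := A.den ++ B.num
  hκ := div_ne_zero A.hκ B.hκ
  hnum := fun a ha => by
    rcases List.mem_append.1 ha with h | h
    · exact A.hnum a h
    · exact B.hden a h
  hden := fun a ha => by
    rcases List.mem_append.1 ha with h | h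
    · exact A.hden a h
    · exact B.hnum a h

/-- `val_div` (API of the exact DiDIL objects). [cite: DuttaDwivediSaxena2022, §3 proof of Thm. 3.2, "Invertibility of `ΠΣ`-circuits", `U_{i,j+1} := ε^{-a}·U_{i,j}·V_{k-j,j}`, `V_{i,j+1} := V_{i,j}·U_{k-j,j}` (full version p0031 L836–845)] -/
theorem val_div (A B : PiRatio K n) : (A.div B).val = A.val / B.val := by
  have h1 := A.algebraMap_den_ne_zero
  have h2 := B.algebraMap_den_ne_zero
  have h3 := B.algebraMap_num_ne_zero
  have hκB : algebraMap (MvPolynomial (Fin n) K) (FractionRing (MvPolynomial (Fin n) K)) (C B.κ) ≠ 0 :=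
    fun h => (C_eq_zero.not.2 B.hκ) ((IsFractionRing.injective _ _) (by rw [h, map_zero]))
  rw [map_mul] at h3
  have hC : algebraMap (MvPolynomial (Fin n) K) (FractionRing (MvPolynomial (Fin n) K)) (C (A.κ / B.κ)) =
      algebraMap (MvPolynomial (Fin n) K) (FractionRing (MvPolynomial (Fin n) K)) (C A.κ) /
        algebraMap (MvPolynomial (Fin n) K) (FractionRing (MvPolynomial (Fin n) K)) (C B.κ) := by
    rw [eq_div_iff hκB, ← map_mul, ← C_mul, div_mul_cancel₀ _ B.hκ]
  simp only [val, div, formProd_append, map_mul, hC]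
  field_simp

/-- The logarithmic derivative `E₀(val A) / val A = E₀(∏num)/∏num − E₀(∏den)/∏den` of a `ΠΣ`-ratio,
as a fraction over the forms of `A`.
[cite: DuttaDwivediSaxena2022, §3 proof of Thm. 3.2, eq. (3.3) and "dlog distributes the product additively … dlog(ΠΣ/ΠΣ) ∈ Σ dlog(Σ)" (full version p0031 L836–838, p0032 L854–862, p0033 L873–877)] -/
def dlog (E₀ : Derivation K (MvPolynomial (Fin n) K) (MvPolynomial (Fin n) K)) (A : PiRatio K n) :
    FracPair K n :=
  (⟨E₀ (formProd A.num), A.num, A.hnum⟩ : FracPair K n).sub ⟨E₀ (formProd A.den), A.den, A.hden⟩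

/-- `dlog_L` (API of the exact DiDIL objects). [cite: DuttaDwivediSaxena2022, §3 proof of Thm. 3.2, eq. (3.3) and "dlog distributes the product additively … dlog(ΠΣ/ΠΣ) ∈ Σ dlog(Σ)" (full version p0031 L836–838, p0032 L854–862, p0033 L873–877)] -/
@[simp] theorem dlog_L (E₀ : Derivation K (MvPolynomial (Fin n) K) (MvPolynomial (Fin n) K))
    (A : PiRatio K n) : (A.dlog E₀).L = A.num ++ A.den := rfl

/-- `val_dlog` (API of the exact DiDIL objects). [cite: DuttaDwivediSaxena2022, §3 proof of Thm. 3.2, eq. (3.3) and "dlog distributes the product additively … dlog(ΠΣ/ΠΣ) ∈ Σ dlog(Σ)" (full version p0031 L836–838, p0032 L854–862, p0033 L873–877)] -/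
theorem val_dlog {E₀ : Derivation K (MvPolynomial (Fin n) K) (MvPolynomial (Fin n) K)}
    {D : Derivation K (FractionRing (MvPolynomial (Fin n) K))
      (FractionRing (MvPolynomial (Fin n) K))}
    (hD : ExtendsDer K n E₀ D) (A : PiRatio K n) : (A.dlog E₀).val = D A.val / A.val := by
  have h1 := A.algebraMap_den_ne_zero
  have h3 := A.algebraMap_num_ne_zero
  have hκ : algebraMap (MvPolynomial (Fin n) K) (FractionRing (MvPolynomial (Fin n) K)) (C A.κ) ≠ 0 :=
    fun h => (C_eq_zero.not.2 A.hκ) ((IsFractionRing.injective _ _) (by rw [h, map_zero]))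
  have hnum : algebraMap (MvPolynomial (Fin n) K) (FractionRing (MvPolynomial (Fin n) K))
      (formProd A.num) ≠ 0 :=
    fun h => (formProd_ne_zero A.hnum) ((IsFractionRing.injective _ _) (by rw [h, map_zero]))
  have hDκ : D (algebraMap (MvPolynomial (Fin n) K) (FractionRing (MvPolynomial (Fin n) K)) (C A.κ)) = 0 := by
    rw [hD, ← MvPolynomial.algebraMap_eq, Derivation.map_algebraMap, map_zero]
  rw [dlog, FracPair.val_sub]
  simp only [FracPair.val, FracPair.den, val, map_mul]
  rw [D.leibniz_div, D.leibniz, hDκ, hD, hD]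
  simp only [smul_eq_mul]
  field_simp
  ring

end PiRatio

/-! ### Exact bloated terms `A · 𝒫 / 𝒬` and the DiDIL step -/

variable (K n) in
/-- An exact term `T = A · 𝒫 / 𝒬` of the DiDIL induction in the graded frame: `A` a `ΠΣ`-ratio,
`𝒫, 𝒬` fractions with affine-form denominators, `𝒬 ≠ 0`.
[cite: DuttaDwivediSaxena2022, §3 proof of Thm. 3.2, the terms `(U/V)·(P/Q)` of the DiDIL induction and Claim 3.6 (full version p0030 L801–805, p0031 L836–845, p0032 L848–850)] -/
structure ExactTerm where
  /-- the `ΠΣ`-ratio factor -/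
  A : PiRatio K n
  /-- the `Σ∧Σ`-type numerator fraction -/
  P : FracPair K n
  /-- the `Σ∧Σ`-type denominator fraction -/
  Q : FracPair K n

namespace ExactTerm

/-- The value `A · 𝒫 / 𝒬` in `K(x)`.
[cite: DuttaDwivediSaxena2022, §3 proof of Thm. 3.2, Divide and Derive, eq. (3.2) and `T_{i,j+1} := (T_{i,j}/T̃_{k-j,j})·dlog(T_{i,j}/T̃_{k-j,j})` (full version p0030 L808–812, p0031 L815–817)] -/
def val (T : ExactTerm K n) : FractionRing (MvPolynomial (Fin n) K) := T.A.val * T.P.val / T.Q.val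

/-- Well-formedness: the denominator fraction `𝒬` has a nonzero numerator.
[cite: DuttaDwivediSaxena2022, §3 proof of Thm. 3.2, Divide and Derive, eq. (3.2) and `T_{i,j+1} := (T_{i,j}/T̃_{k-j,j})·dlog(T_{i,j}/T̃_{k-j,j})` (full version p0030 L808–812, p0031 L815–817)] -/
def WF (T : ExactTerm K n) : Prop := T.Q.p ≠ 0

/-- Nondegeneracy: the numerator fraction `𝒫` has a nonzero numerator (so `val T ≠ 0`; required of a
divisor term).
[cite: DuttaDwivediSaxena2022, §3 proof of Thm. 3.2, Divide and Derive, eq. (3.2) and `T_{i,j+1} := (T_{i,j}/T̃_{k-j,j})·dlog(T_{i,j}/T̃_{k-j,j})` (full version p0030 L808–812, p0031 L815–817)] -/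
def ND (T : ExactTerm K n) : Prop := T.P.p ≠ 0

/-- `Q_val_ne_zero` (API of the exact DiDIL objects). [cite: DuttaDwivediSaxena2022, §3 proof of Thm. 3.2, Divide and Derive, eq. (3.2) and `T_{i,j+1} := (T_{i,j}/T̃_{k-j,j})·dlog(T_{i,j}/T̃_{k-j,j})` (full version p0030 L808–812, p0031 L815–817)] -/
theorem Q_val_ne_zero (T : ExactTerm K n) (hT : T.WF) : T.Q.val ≠ 0 :=
  div_ne_zero (fun h => hT ((IsFractionRing.injective _ _) (by rw [h, map_zero])))
    T.Q.algebraMap_den_ne_zero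

/-- `P_val_ne_zero` (API of the exact DiDIL objects). [cite: DuttaDwivediSaxena2022, §3 proof of Thm. 3.2, Divide and Derive, eq. (3.2) and `T_{i,j+1} := (T_{i,j}/T̃_{k-j,j})·dlog(T_{i,j}/T̃_{k-j,j})` (full version p0030 L808–812, p0031 L815–817)] -/
theorem P_val_ne_zero (T : ExactTerm K n) (hP : T.ND) : T.P.val ≠ 0 :=
  div_ne_zero (fun h => hP ((IsFractionRing.injective _ _) (by rw [h, map_zero])))
    T.P.algebraMap_den_ne_zero

/-- `val_ne_zero` (API of the exact DiDIL objects). [cite: DuttaDwivediSaxena2022, §3 proof of Thm. 3.2, Divide and Derive, eq. (3.2) and `T_{i,j+1} := (T_{i,j}/T̃_{k-j,j})·dlog(T_{i,j}/T̃_{k-j,j})` (full version p0030 L808–812, p0031 L815–817)] -/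
theorem val_ne_zero (T : ExactTerm K n) (hT : T.WF) (hP : T.ND) : T.val ≠ 0 :=
  div_ne_zero (mul_ne_zero T.A.val_ne_zero (T.P_val_ne_zero hP)) (T.Q_val_ne_zero hT)

/-- A well-formed term vanishes iff it is degenerate (`𝒫` has zero numerator): the divisor of a DiDIL
step may be ANY nonzero term (MEMO-t21g12 F6; print: "Wlog, assume that `min_i v_{i,j} = v_{k-j,j}`").
[cite: DuttaDwivediSaxena2022, §3 proof of Thm. 3.2, induction hypothesis (3) (full version p0030 L804–805)] -/
theorem val_eq_zero_iff (T : ExactTerm K n) (hT : T.WF) : T.val = 0 ↔ ¬ T.ND := by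
  constructor
  · intro h
    by_contra hP
    exact T.val_ne_zero hT hP h
  · intro h
    have hp : T.P.p = 0 := by
      by_contra hp
      exact h hp
    simp [val, FracPair.val, hp]

/-- The term `κ · ∏_{a ∈ L} affForm a` (a shifted `ΠΣ` product: the stage-`0` input of DiDIL, with
`𝒫 = 𝒬 = 1`).
[cite: DuttaDwivediSaxena2022, §3 proof of Thm. 3.2, the terms `(U/V)·(P/Q)` of the DiDIL induction and Claim 3.6 (full version p0030 L801–805, p0031 L836–845, p0032 L848–850)] -/
def ofForms (κ : K) (hκ : κ ≠ 0) (L : List (Option (Fin n) → K)) (hL : ∀ a ∈ L, a none ≠ 0) :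
    ExactTerm K n :=
  ⟨⟨κ, L, [], hκ, hL, by simp⟩, FracPair.ofPoly 1, FracPair.ofPoly 1⟩

/-- `wf_ofForms` (API of the exact DiDIL objects). [cite: DuttaDwivediSaxena2022, §3 proof of Thm. 3.2, the terms `(U/V)·(P/Q)` of the DiDIL induction and Claim 3.6 (full version p0030 L801–805, p0031 L836–845, p0032 L848–850)] -/
theorem wf_ofForms (κ : K) (hκ : κ ≠ 0) (L : List (Option (Fin n) → K))
    (hL : ∀ a ∈ L, a none ≠ 0) : (ofForms κ hκ L hL).WF := by
  simp [WF, ofForms]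

/-- `nd_ofForms` (API of the exact DiDIL objects). [cite: DuttaDwivediSaxena2022, §3 proof of Thm. 3.2, the terms `(U/V)·(P/Q)` of the DiDIL induction and Claim 3.6 (full version p0030 L801–805, p0031 L836–845, p0032 L848–850)] -/
theorem nd_ofForms (κ : K) (hκ : κ ≠ 0) (L : List (Option (Fin n) → K))
    (hL : ∀ a ∈ L, a none ≠ 0) : (ofForms κ hκ L hL).ND := by
  simp [ND, ofForms]

/-- `val_ofForms` (API of the exact DiDIL objects). [cite: DuttaDwivediSaxena2022, §3 proof of Thm. 3.2, the terms `(U/V)·(P/Q)` of the DiDIL induction and Claim 3.6 (full version p0030 L801–805, p0031 L836–845, p0032 L848–850)] -/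
theorem val_ofForms (κ : K) (hκ : κ ≠ 0) (L : List (Option (Fin n) → K))
    (hL : ∀ a ∈ L, a none ≠ 0) :
    (ofForms κ hκ L hL).val =
      algebraMap (MvPolynomial (Fin n) K) (FractionRing (MvPolynomial (Fin n) K)) (C κ * formProd L) := by
  simp [val, ofForms, PiRatio.val, FracPair.val_ofPoly]

/-- Scalar multiple of a term (the scalar goes into `κ`).
[cite: DuttaDwivediSaxena2022, §3 proof of Thm. 3.2, the terms `(U/V)·(P/Q)` of the DiDIL induction and Claim 3.6 (full version p0030 L801–805, p0031 L836–845, p0032 L848–850)] -/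
def smul (c : K) (hc : c ≠ 0) (T : ExactTerm K n) : ExactTerm K n :=
  ⟨⟨c * T.A.κ, T.A.num, T.A.den, mul_ne_zero hc T.A.hκ, T.A.hnum, T.A.hden⟩, T.P, T.Q⟩

/-- `val_smul` (API of the exact DiDIL objects). [cite: DuttaDwivediSaxena2022, §3 proof of Thm. 3.2, the terms `(U/V)·(P/Q)` of the DiDIL induction and Claim 3.6 (full version p0030 L801–805, p0031 L836–845, p0032 L848–850)] -/
theorem val_smul (c : K) (hc : c ≠ 0) (T : ExactTerm K n) :
    (T.smul c hc).val =
      algebraMap (MvPolynomial (Fin n) K) (FractionRing (MvPolynomial (Fin n) K)) (C c) * T.val := by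
  simp only [val, smul, PiRatio.val, map_mul]
  ring

/-- Quotient of two exact terms, `(A·𝒫/𝒬) / (A'·𝒫'/𝒬') = (A/A') · (𝒫𝒬') / (𝒬𝒫')`
("`T_{i,j}/T̃_{k-j,j} = (U_{i,j+1}/V_{i,j+1}) · (P_{i,j} Q_{k-j,j})/(Q_{i,j} P_{k-j,j})`").
[cite: DuttaDwivediSaxena2022, §3 proof of Thm. 3.2, Divide and Derive, eq. (3.2) and `T_{i,j+1} := (T_{i,j}/T̃_{k-j,j})·dlog(T_{i,j}/T̃_{k-j,j})` (full version p0030 L808–812, p0031 L815–817)] -/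
def divT (T S : ExactTerm K n) : ExactTerm K n :=
  ⟨T.A.div S.A, T.P.mul S.Q, T.Q.mul S.P⟩

/-- `wf_divT` (API of the exact DiDIL objects). [cite: DuttaDwivediSaxena2022, §3 proof of Thm. 3.2, Divide and Derive, eq. (3.2) and `T_{i,j+1} := (T_{i,j}/T̃_{k-j,j})·dlog(T_{i,j}/T̃_{k-j,j})` (full version p0030 L808–812, p0031 L815–817)] -/
theorem wf_divT {T S : ExactTerm K n} (hT : T.WF) (hS : S.ND) : (T.divT S).WF :=
  mul_ne_zero hT hS

/-- `nd_divT` (API of the exact DiDIL objects). [cite: DuttaDwivediSaxena2022, §3 proof of Thm. 3.2, Divide and Derive, eq. (3.2) and `T_{i,j+1} := (T_{i,j}/T̃_{k-j,j})·dlog(T_{i,j}/T̃_{k-j,j})` (full version p0030 L808–812, p0031 L815–817)] -/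
theorem nd_divT {T S : ExactTerm K n} (hT : T.ND) (hS : S.WF) : (T.divT S).ND :=
  mul_ne_zero hT hS

/-- `val_divT` (API of the exact DiDIL objects). [cite: DuttaDwivediSaxena2022, §3 proof of Thm. 3.2, Divide and Derive, eq. (3.2) and `T_{i,j+1} := (T_{i,j}/T̃_{k-j,j})·dlog(T_{i,j}/T̃_{k-j,j})` (full version p0030 L808–812, p0031 L815–817)] -/
theorem val_divT (T S : ExactTerm K n) (hT : T.WF) (hS : S.WF) (hS' : S.ND) :
    (T.divT S).val = T.val / S.val := by
  have := S.Q_val_ne_zero hS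
  have := S.P_val_ne_zero hS'
  have := T.Q_val_ne_zero hT
  have := S.A.val_ne_zero
  simp only [val, divT, PiRatio.val_div, FracPair.val_mul]
  field_simp

/-- The derivative of an exact term along a derivation `E₀` of `K[x]`, again an exact term:
`E(A·𝒫/𝒬) = A · ((EA/A)·𝒫·𝒬 + E𝒫·𝒬 − 𝒫·E𝒬) / 𝒬²`.
[cite: DuttaDwivediSaxena2022, §3 proof of Thm. 3.2, Divide and Derive, eq. (3.2) and `T_{i,j+1} := (T_{i,j}/T̃_{k-j,j})·dlog(T_{i,j}/T̃_{k-j,j})` (full version p0030 L808–812, p0031 L815–817)] -/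
def derT (E₀ : Derivation K (MvPolynomial (Fin n) K) (MvPolynomial (Fin n) K)) (T : ExactTerm K n) :
    ExactTerm K n :=
  ⟨T.A, ((T.A.dlog E₀).mul (T.P.mul T.Q)).add (((T.P.der E₀).mul T.Q).sub (T.P.mul (T.Q.der E₀))),
    T.Q.mul T.Q⟩

/-- `wf_derT` (API of the exact DiDIL objects). [cite: DuttaDwivediSaxena2022, §3 proof of Thm. 3.2, Divide and Derive, eq. (3.2) and `T_{i,j+1} := (T_{i,j}/T̃_{k-j,j})·dlog(T_{i,j}/T̃_{k-j,j})` (full version p0030 L808–812, p0031 L815–817)] -/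
theorem wf_derT (E₀ : Derivation K (MvPolynomial (Fin n) K) (MvPolynomial (Fin n) K))
    {T : ExactTerm K n} (hT : T.WF) : (T.derT E₀).WF :=
  mul_ne_zero hT hT

/-- `val_derT` (API of the exact DiDIL objects). [cite: DuttaDwivediSaxena2022, §3 proof of Thm. 3.2, Divide and Derive, eq. (3.2) and `T_{i,j+1} := (T_{i,j}/T̃_{k-j,j})·dlog(T_{i,j}/T̃_{k-j,j})` (full version p0030 L808–812, p0031 L815–817)] -/
theorem val_derT {E₀ : Derivation K (MvPolynomial (Fin n) K) (MvPolynomial (Fin n) K)}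
    {D : Derivation K (FractionRing (MvPolynomial (Fin n) K))
      (FractionRing (MvPolynomial (Fin n) K))}
    (hD : ExtendsDer K n E₀ D) (T : ExactTerm K n) (hT : T.WF) : (T.derT E₀).val = D T.val := by
  have hQ := T.Q_val_ne_zero hT
  have hA := T.A.val_ne_zero
  simp only [val, derT, FracPair.val_add, FracPair.val_sub, FracPair.val_mul, FracPair.val_der hD,
    PiRatio.val_dlog hD]
  rw [D.leibniz_div, D.leibniz]
  simp only [smul_eq_mul]
  field_simp
  ring

/-- **The DiDIL operation on one term**: `T ↦ E(T / S)` for the divisor term `S`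
("`T_{i,j+1} := (T_{i,j}/T̃) · dlog(T_{i,j}/T̃)`", with `E = z∂_z` in the graded frame).
[cite: DuttaDwivediSaxena2022, §3 proof of Thm. 3.2, Divide and Derive, eq. (3.2) and `T_{i,j+1} := (T_{i,j}/T̃_{k-j,j})·dlog(T_{i,j}/T̃_{k-j,j})` (full version p0030 L808–812, p0031 L815–817)] -/
def didil (E₀ : Derivation K (MvPolynomial (Fin n) K) (MvPolynomial (Fin n) K))
    (T S : ExactTerm K n) : ExactTerm K n :=
  (T.divT S).derT E₀

/-- `wf_didil` (API of the exact DiDIL objects). [cite: DuttaDwivediSaxena2022, §3 proof of Thm. 3.2, Divide and Derive, eq. (3.2) and `T_{i,j+1} := (T_{i,j}/T̃_{k-j,j})·dlog(T_{i,j}/T̃_{k-j,j})` (full version p0030 L808–812, p0031 L815–817)] -/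
theorem wf_didil (E₀ : Derivation K (MvPolynomial (Fin n) K) (MvPolynomial (Fin n) K))
    {T S : ExactTerm K n} (hT : T.WF) (hS : S.ND) : (didil E₀ T S).WF :=
  wf_derT E₀ (wf_divT hT hS)

/-- `val_didil` (API of the exact DiDIL objects). [cite: DuttaDwivediSaxena2022, §3 proof of Thm. 3.2, Divide and Derive, eq. (3.2) and `T_{i,j+1} := (T_{i,j}/T̃_{k-j,j})·dlog(T_{i,j}/T̃_{k-j,j})` (full version p0030 L808–812, p0031 L815–817)] -/
theorem val_didil {E₀ : Derivation K (MvPolynomial (Fin n) K) (MvPolynomial (Fin n) K)}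
    {D : Derivation K (FractionRing (MvPolynomial (Fin n) K))
      (FractionRing (MvPolynomial (Fin n) K))}
    (hD : ExtendsDer K n E₀ D) (T S : ExactTerm K n) (hT : T.WF) (hS : S.WF) (hS' : S.ND) :
    (didil E₀ T S).val = D (T.val / S.val) := by
  rw [didil, val_derT hD _ (wf_divT hT hS'), val_divT _ _ hT hS hS']

end ExactTerm

/-- **One DiDIL step** on a family of `m + 1` exact terms with divisor index `i₀`: the `m` new terms
`E(T_i / T_{i₀})`, `i ≠ i₀`.
[cite: DuttaDwivediSaxena2022, §3 proof of Thm. 3.2, Divide and Derive, eq. (3.2) and `T_{i,j+1} := (T_{i,j}/T̃_{k-j,j})·dlog(T_{i,j}/T̃_{k-j,j})` (full version p0030 L808–812, p0031 L815–817)] -/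
def didilStep (E₀ : Derivation K (MvPolynomial (Fin n) K) (MvPolynomial (Fin n) K)) {m : ℕ}
    (G : Fin (m + 1) → ExactTerm K n) (i₀ : Fin (m + 1)) : Fin m → ExactTerm K n :=
  fun i => ExactTerm.didil E₀ (G (i₀.succAbove i)) (G i₀)

/-- `wf_didilStep` (API of the exact DiDIL objects). [cite: DuttaDwivediSaxena2022, §3 proof of Thm. 3.2, Divide and Derive, eq. (3.2) and `T_{i,j+1} := (T_{i,j}/T̃_{k-j,j})·dlog(T_{i,j}/T̃_{k-j,j})` (full version p0030 L808–812, p0031 L815–817)] -/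
theorem wf_didilStep (E₀ : Derivation K (MvPolynomial (Fin n) K) (MvPolynomial (Fin n) K)) {m : ℕ}
    {G : Fin (m + 1) → ExactTerm K n} (hG : ∀ i, (G i).WF) {i₀ : Fin (m + 1)} (h : (G i₀).ND)
    (i : Fin m) : (didilStep E₀ G i₀ i).WF :=
  ExactTerm.wf_didil E₀ (hG _) h

/-- **The DiDIL identity (3.2), exact form**: `Σ_{i ≠ i₀} E(T_i/T_{i₀}) = E((Σ_i T_i)/T_{i₀})`.
[cite: DuttaDwivediSaxena2022, §3 proof of Thm. 3.2, Divide and Derive, eq. (3.2) and `T_{i,j+1} := (T_{i,j}/T̃_{k-j,j})·dlog(T_{i,j}/T̃_{k-j,j})` (full version p0030 L808–812, p0031 L815–817)] -/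
theorem sum_val_didilStep {E₀ : Derivation K (MvPolynomial (Fin n) K) (MvPolynomial (Fin n) K)}
    {D : Derivation K (FractionRing (MvPolynomial (Fin n) K))
      (FractionRing (MvPolynomial (Fin n) K))}
    (hD : ExtendsDer K n E₀ D) {m : ℕ} (G : Fin (m + 1) → ExactTerm K n) (hG : ∀ i, (G i).WF)
    (i₀ : Fin (m + 1)) (h : (G i₀).ND) :
    ∑ i, (didilStep E₀ G i₀ i).val = D ((∑ i, (G i).val) / (G i₀).val) := by
  have h0 := (G i₀).val_ne_zero (hG i₀) h
  simp only [didilStep, ExactTerm.val_didil hD _ _ (hG _) (hG i₀) h]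
  rw [← map_sum, Fin.sum_univ_succAbove _ i₀, add_div, Finset.sum_div, div_self h0, map_add,
    D.leibniz_of_mul_eq_one (one_mul (1 : FractionRing (MvPolynomial (Fin n) K)))]
  simp


/-! ### Size bookkeeping: number of forms and degrees of numerators -/

/-- `totalDegree_affForm_le` (API of the exact DiDIL objects). [cite: DuttaDwivediSaxena2022, Def. 3.1 and §2.3 (`ΠΣ` = products of affine forms, `Σ∧Σ`), full version p0026 L702–707, p0020 L537–540] -/
theorem totalDegree_affForm_le (a : Option (Fin n) → K) : (affForm a).totalDegree ≤ 1 := by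
  classical
  refine (totalDegree_add _ _).trans (max_le ?_ ?_)
  · rw [totalDegree_C]; exact Nat.zero_le _
  · refine (totalDegree_finsetSum _ _).trans (Finset.sup_le fun m _ => ?_)
    exact (totalDegree_mul _ _).trans (by rw [totalDegree_C, totalDegree_X, zero_add])

/-- `totalDegree_formProd_le` (API of the exact DiDIL objects). [cite: DuttaDwivediSaxena2022, Def. 3.1 and §2.3 (`ΠΣ` = products of affine forms, `Σ∧Σ`), full version p0026 L702–707, p0020 L537–540] -/
theorem totalDegree_formProd_le (L : List (Option (Fin n) → K)) :
    (formProd L).totalDegree ≤ L.length := by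
  induction L with
  | nil => simp
  | cons a L ih =>
    rw [formProd_cons, List.length_cons]
    refine (totalDegree_mul _ _).trans ?_
    have := totalDegree_affForm_le a
    omega

/-- A derivation of `K[x]` that does not raise total degrees (e.g. the Euler operator).
[cite: DuttaDwivediSaxena2022, Def. 3.1 and §2.3 (`ΠΣ` = products of affine forms, `Σ∧Σ`), full version p0026 L702–707, p0020 L537–540] -/
def DegLE (E₀ : Derivation K (MvPolynomial (Fin n) K) (MvPolynomial (Fin n) K)) : Prop :=
  ∀ p : MvPolynomial (Fin n) K, (E₀ p).totalDegree ≤ p.totalDegree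

namespace FracPair

/-- `totalDegree_den_le` (API of the exact DiDIL objects). [cite: DuttaDwivediSaxena2022, §3 proof of Thm. 3.2, Claim 3.6 (size and syntactic-degree recursion `D_{j+1} = O(d·D_j)`, full version p0032 L848–850, p0033 L880–887)] -/
theorem totalDegree_den_le (P : FracPair K n) : P.den.totalDegree ≤ P.L.length :=
  totalDegree_formProd_le P.L

/-- `length_mul` (API of the exact DiDIL objects). [cite: DuttaDwivediSaxena2022, §3 proof of Thm. 3.2, Claim 3.6 (size and syntactic-degree recursion `D_{j+1} = O(d·D_j)`, full version p0032 L848–850, p0033 L880–887)] -/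
theorem length_mul (P Q : FracPair K n) : (P.mul Q).L.length = P.L.length + Q.L.length := by
  simp

/-- `totalDegree_mul_le` (API of the exact DiDIL objects). [cite: DuttaDwivediSaxena2022, §3 proof of Thm. 3.2, Claim 3.6 (size and syntactic-degree recursion `D_{j+1} = O(d·D_j)`, full version p0032 L848–850, p0033 L880–887)] -/
theorem totalDegree_mul_le (P Q : FracPair K n) :
    (P.mul Q).p.totalDegree ≤ P.p.totalDegree + Q.p.totalDegree :=
  totalDegree_mul _ _

/-- `length_add` (API of the exact DiDIL objects). [cite: DuttaDwivediSaxena2022, §3 proof of Thm. 3.2, Claim 3.6 (size and syntactic-degree recursion `D_{j+1} = O(d·D_j)`, full version p0032 L848–850, p0033 L880–887)] -/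
theorem length_add (P Q : FracPair K n) : (P.add Q).L.length = P.L.length + Q.L.length := by
  simp

/-- `totalDegree_add_le` (API of the exact DiDIL objects). [cite: DuttaDwivediSaxena2022, §3 proof of Thm. 3.2, Claim 3.6 (size and syntactic-degree recursion `D_{j+1} = O(d·D_j)`, full version p0032 L848–850, p0033 L880–887)] -/
theorem totalDegree_add_le (P Q : FracPair K n) :
    (P.add Q).p.totalDegree ≤ max (P.p.totalDegree + Q.L.length) (Q.p.totalDegree + P.L.length) := by
  rw [add_p]
  refine (totalDegree_add _ _).trans (max_le_max ?_ ?_)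
  · exact (totalDegree_mul _ _).trans (Nat.add_le_add_left Q.totalDegree_den_le _)
  · exact (totalDegree_mul _ _).trans (Nat.add_le_add_left P.totalDegree_den_le _)

/-- `length_neg` (API of the exact DiDIL objects). [cite: DuttaDwivediSaxena2022, §3 proof of Thm. 3.2, Claim 3.6 (size and syntactic-degree recursion `D_{j+1} = O(d·D_j)`, full version p0032 L848–850, p0033 L880–887)] -/
theorem length_neg (P : FracPair K n) : P.neg.L.length = P.L.length := rfl

/-- `totalDegree_neg` (API of the exact DiDIL objects). [cite: DuttaDwivediSaxena2022, §3 proof of Thm. 3.2, Claim 3.6 (size and syntactic-degree recursion `D_{j+1} = O(d·D_j)`, full version p0032 L848–850, p0033 L880–887)] -/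
theorem totalDegree_neg (P : FracPair K n) : P.neg.p.totalDegree = P.p.totalDegree := by
  rw [neg_p, MvPolynomial.totalDegree_neg]

/-- `length_sub` (API of the exact DiDIL objects). [cite: DuttaDwivediSaxena2022, §3 proof of Thm. 3.2, Claim 3.6 (size and syntactic-degree recursion `D_{j+1} = O(d·D_j)`, full version p0032 L848–850, p0033 L880–887)] -/
theorem length_sub (P Q : FracPair K n) : (P.sub Q).L.length = P.L.length + Q.L.length := by
  simp

/-- `totalDegree_sub_le` (API of the exact DiDIL objects). [cite: DuttaDwivediSaxena2022, §3 proof of Thm. 3.2, Claim 3.6 (size and syntactic-degree recursion `D_{j+1} = O(d·D_j)`, full version p0032 L848–850, p0033 L880–887)] -/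
theorem totalDegree_sub_le (P Q : FracPair K n) :
    (P.sub Q).p.totalDegree ≤ max (P.p.totalDegree + Q.L.length) (Q.p.totalDegree + P.L.length) := by
  have h := totalDegree_add_le P Q.neg
  rwa [totalDegree_neg, length_neg] at h

/-- `length_smul` (API of the exact DiDIL objects). [cite: DuttaDwivediSaxena2022, §3 proof of Thm. 3.2, Claim 3.6 (size and syntactic-degree recursion `D_{j+1} = O(d·D_j)`, full version p0032 L848–850, p0033 L880–887)] -/
theorem length_smul (c : K) (P : FracPair K n) : (P.smul c).L.length = P.L.length := rfl

/-- `totalDegree_smul_le` (API of the exact DiDIL objects). [cite: DuttaDwivediSaxena2022, §3 proof of Thm. 3.2, Claim 3.6 (size and syntactic-degree recursion `D_{j+1} = O(d·D_j)`, full version p0032 L848–850, p0033 L880–887)] -/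
theorem totalDegree_smul_le (c : K) (P : FracPair K n) :
    (P.smul c).p.totalDegree ≤ P.p.totalDegree :=
  (totalDegree_mul _ _).trans (by rw [totalDegree_C, zero_add])

/-- `length_der` (API of the exact DiDIL objects). [cite: DuttaDwivediSaxena2022, §3 proof of Thm. 3.2, Claim 3.6 (size and syntactic-degree recursion `D_{j+1} = O(d·D_j)`, full version p0032 L848–850, p0033 L880–887)] -/
theorem length_der (E₀ : Derivation K (MvPolynomial (Fin n) K) (MvPolynomial (Fin n) K))
    (P : FracPair K n) : (P.der E₀).L.length = 2 * P.L.length := by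
  simp [two_mul]

/-- `totalDegree_der_le` (API of the exact DiDIL objects). [cite: DuttaDwivediSaxena2022, §3 proof of Thm. 3.2, Claim 3.6 (size and syntactic-degree recursion `D_{j+1} = O(d·D_j)`, full version p0032 L848–850, p0033 L880–887)] -/
theorem totalDegree_der_le {E₀ : Derivation K (MvPolynomial (Fin n) K) (MvPolynomial (Fin n) K)}
    (hE : DegLE E₀) (P : FracPair K n) :
    (P.der E₀).p.totalDegree ≤ P.p.totalDegree + P.L.length := by
  rw [der_p]
  refine (totalDegree_sub _ _).trans (max_le ?_ ?_)
  · exact (totalDegree_mul _ _).trans (add_le_add (hE _) P.totalDegree_den_le)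
  · exact (totalDegree_mul _ _).trans
      (Nat.add_le_add_left ((hE _).trans P.totalDegree_den_le) _)

end FracPair

namespace PiRatio

/-- `length_num_div` (API of the exact DiDIL objects). [cite: DuttaDwivediSaxena2022, §3 proof of Thm. 3.2, Claim 3.6 (size and syntactic-degree recursion `D_{j+1} = O(d·D_j)`, full version p0032 L848–850, p0033 L880–887)] -/
theorem length_num_div (A B : PiRatio K n) : (A.div B).num.length = A.num.length + B.den.length := by
  simp [div]

/-- `length_den_div` (API of the exact DiDIL objects). [cite: DuttaDwivediSaxena2022, §3 proof of Thm. 3.2, Claim 3.6 (size and syntactic-degree recursion `D_{j+1} = O(d·D_j)`, full version p0032 L848–850, p0033 L880–887)] -/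
theorem length_den_div (A B : PiRatio K n) : (A.div B).den.length = A.den.length + B.num.length := by
  simp [div]

/-- `length_dlog` (API of the exact DiDIL objects). [cite: DuttaDwivediSaxena2022, §3 proof of Thm. 3.2, eq. (3.3) and "dlog distributes the product additively … dlog(ΠΣ/ΠΣ) ∈ Σ dlog(Σ)" (full version p0031 L836–838, p0032 L854–862, p0033 L873–877)] -/
theorem length_dlog (E₀ : Derivation K (MvPolynomial (Fin n) K) (MvPolynomial (Fin n) K))
    (A : PiRatio K n) : (A.dlog E₀).L.length = A.num.length + A.den.length := by
  simp

/-- `totalDegree_dlog_le` (API of the exact DiDIL objects). [cite: DuttaDwivediSaxena2022, §3 proof of Thm. 3.2, eq. (3.3) and "dlog distributes the product additively … dlog(ΠΣ/ΠΣ) ∈ Σ dlog(Σ)" (full version p0031 L836–838, p0032 L854–862, p0033 L873–877)] -/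
theorem totalDegree_dlog_le {E₀ : Derivation K (MvPolynomial (Fin n) K) (MvPolynomial (Fin n) K)}
    (hE : DegLE E₀) (A : PiRatio K n) :
    (A.dlog E₀).p.totalDegree ≤ A.num.length + A.den.length := by
  refine (FracPair.totalDegree_sub_le _ _).trans (max_le ?_ ?_)
  · exact Nat.add_le_add_right ((hE _).trans (totalDegree_formProd_le _)) _
  · have h := (hE (formProd A.den)).trans (totalDegree_formProd_le A.den)
    change (E₀ (formProd A.den)).totalDegree + A.num.length ≤ _
    omega

end PiRatio

namespace ExactTerm

/-- Uniform size bound `B` on an exact term: at most `B` forms in each of the four form lists and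
numerators of total degree `≤ B`.
[cite: DuttaDwivediSaxena2022, §3 proof of Thm. 3.2, Claim 3.6 (size and syntactic-degree recursion `D_{j+1} = O(d·D_j)`, full version p0032 L848–850, p0033 L880–887)] -/
def Bdd (B : ℕ) (T : ExactTerm K n) : Prop :=
  T.A.num.length ≤ B ∧ T.A.den.length ≤ B ∧ T.P.p.totalDegree ≤ B ∧ T.P.L.length ≤ B ∧
    T.Q.p.totalDegree ≤ B ∧ T.Q.L.length ≤ B

/-- `Bdd.mono` (API of the exact DiDIL objects). [cite: DuttaDwivediSaxena2022, §3 proof of Thm. 3.2, Claim 3.6 (size and syntactic-degree recursion `D_{j+1} = O(d·D_j)`, full version p0032 L848–850, p0033 L880–887)] -/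
theorem Bdd.mono {B B' : ℕ} {T : ExactTerm K n} (h : T.Bdd B) (hB : B ≤ B') : T.Bdd B' := by
  obtain ⟨h1, h2, h3, h4, h5, h6⟩ := h
  exact ⟨h1.trans hB, h2.trans hB, h3.trans hB, h4.trans hB, h5.trans hB, h6.trans hB⟩

/-- `bdd_ofForms` (API of the exact DiDIL objects). [cite: DuttaDwivediSaxena2022, §3 proof of Thm. 3.2, Claim 3.6 (size and syntactic-degree recursion `D_{j+1} = O(d·D_j)`, full version p0032 L848–850, p0033 L880–887)] -/
theorem bdd_ofForms (κ : K) (hκ : κ ≠ 0) (L : List (Option (Fin n) → K))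
    (hL : ∀ a ∈ L, a none ≠ 0) : (ofForms κ hκ L hL).Bdd L.length := by
  refine ⟨le_rfl, ?_, ?_, ?_, ?_, ?_⟩ <;> simp [ofForms, FracPair.ofPoly]

/-- `bdd_smul` (API of the exact DiDIL objects). [cite: DuttaDwivediSaxena2022, §3 proof of Thm. 3.2, Claim 3.6 (size and syntactic-degree recursion `D_{j+1} = O(d·D_j)`, full version p0032 L848–850, p0033 L880–887)] -/
theorem bdd_smul {B : ℕ} (c : K) (hc : c ≠ 0) {T : ExactTerm K n} (h : T.Bdd B) :
    (T.smul c hc).Bdd B := h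

/-- `bdd_divT` (API of the exact DiDIL objects). [cite: DuttaDwivediSaxena2022, §3 proof of Thm. 3.2, Claim 3.6 (size and syntactic-degree recursion `D_{j+1} = O(d·D_j)`, full version p0032 L848–850, p0033 L880–887)] -/
theorem bdd_divT {B : ℕ} {T S : ExactTerm K n} (hT : T.Bdd B) (hS : S.Bdd B) :
    (T.divT S).Bdd (2 * B) := by
  obtain ⟨h1, h2, h3, h4, h5, h6⟩ := hT
  obtain ⟨g1, g2, g3, g4, g5, g6⟩ := hS
  refine ⟨?_, ?_, ?_, ?_, ?_, ?_⟩
  · rw [divT, PiRatio.length_num_div]; omega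
  · rw [divT, PiRatio.length_den_div]; omega
  · exact (FracPair.totalDegree_mul_le _ _).trans (by omega)
  · simp only [divT, FracPair.length_mul]; omega
  · exact (FracPair.totalDegree_mul_le _ _).trans (by omega)
  · simp only [divT, FracPair.length_mul]; omega

/-- `bdd_derT` (API of the exact DiDIL objects). [cite: DuttaDwivediSaxena2022, §3 proof of Thm. 3.2, Claim 3.6 (size and syntactic-degree recursion `D_{j+1} = O(d·D_j)`, full version p0032 L848–850, p0033 L880–887)] -/
theorem bdd_derT {E₀ : Derivation K (MvPolynomial (Fin n) K) (MvPolynomial (Fin n) K)}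
    (hE : DegLE E₀) {B : ℕ} {T : ExactTerm K n} (hT : T.Bdd B) : (T.derT E₀).Bdd (10 * B) := by
  obtain ⟨h1, h2, h3, h4, h5, h6⟩ := hT
  have hdl := PiRatio.totalDegree_dlog_le hE T.A
  have hdlL := PiRatio.length_dlog E₀ T.A
  have hdP := FracPair.totalDegree_der_le hE T.P
  have hdQ := FracPair.totalDegree_der_le hE T.Q
  have hdPL := FracPair.length_der E₀ T.P
  have hdQL := FracPair.length_der E₀ T.Q
  refine ⟨by simp only [derT]; omega, by simp only [derT]; omega, ?_, ?_, ?_, ?_⟩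
  · -- numerator of `𝒫'`
    simp only [derT]
    refine (FracPair.totalDegree_add_le _ _).trans (max_le ?_ ?_)
    · have hm := FracPair.totalDegree_mul_le (T.A.dlog E₀) (T.P.mul T.Q)
      have hm2 := FracPair.totalDegree_mul_le T.P T.Q
      have hl : (((T.P.der E₀).mul T.Q).sub (T.P.mul (T.Q.der E₀))).L.length =
          2 * T.P.L.length + T.Q.L.length + (T.P.L.length + 2 * T.Q.L.length) := by
        simp only [FracPair.length_sub, FracPair.length_mul, hdPL, hdQL]
      rw [hl]
      have : ((T.A.dlog E₀).mul (T.P.mul T.Q)).p.totalDegree ≤ 4 * B :=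
        hm.trans (by have := hm2; simp only [FracPair.mul_p] at *; omega)
      omega
    · have hs := FracPair.totalDegree_sub_le ((T.P.der E₀).mul T.Q) (T.P.mul (T.Q.der E₀))
      have hm1 := FracPair.totalDegree_mul_le (T.P.der E₀) T.Q
      have hm2 := FracPair.totalDegree_mul_le T.P (T.Q.der E₀)
      have hl1 : (T.P.mul (T.Q.der E₀)).L.length = T.P.L.length + 2 * T.Q.L.length := by
        simp only [FracPair.length_mul, hdQL]
      have hl2 : ((T.P.der E₀).mul T.Q).L.length = 2 * T.P.L.length + T.Q.L.length := by
        simp only [FracPair.length_mul, hdPL]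
      have hl3 : ((T.A.dlog E₀).mul (T.P.mul T.Q)).L.length =
          T.A.num.length + T.A.den.length + (T.P.L.length + T.Q.L.length) := by
        simp only [FracPair.length_mul, hdlL]
      rw [hl1, hl2] at hs
      rw [hl3]
      omega
  · simp only [derT, FracPair.length_add, FracPair.length_mul, FracPair.length_sub, hdlL, hdPL,
      hdQL]
    omega
  · simp only [derT]
    exact (FracPair.totalDegree_mul_le _ _).trans (by omega)
  · simp only [derT, FracPair.length_mul]
    omega

/-- `bdd_didil` (API of the exact DiDIL objects). [cite: DuttaDwivediSaxena2022, §3 proof of Thm. 3.2, Claim 3.6 (size and syntactic-degree recursion `D_{j+1} = O(d·D_j)`, full version p0032 L848–850, p0033 L880–887)] -/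
theorem bdd_didil {E₀ : Derivation K (MvPolynomial (Fin n) K) (MvPolynomial (Fin n) K)}
    (hE : DegLE E₀) {B : ℕ} {T S : ExactTerm K n} (hT : T.Bdd B) (hS : S.Bdd B) :
    (didil E₀ T S).Bdd (20 * B) := by
  have h := bdd_derT hE (bdd_divT hT hS)
  rw [← mul_assoc] at h
  exact h

end ExactTerm

/-- `bdd_didilStep` (API of the exact DiDIL objects). [cite: DuttaDwivediSaxena2022, §3 proof of Thm. 3.2, Claim 3.6 (size and syntactic-degree recursion `D_{j+1} = O(d·D_j)`, full version p0032 L848–850, p0033 L880–887)] -/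
theorem bdd_didilStep {E₀ : Derivation K (MvPolynomial (Fin n) K) (MvPolynomial (Fin n) K)}
    (hE : DegLE E₀) {B m : ℕ} {G : Fin (m + 1) → ExactTerm K n} (hG : ∀ i, (G i).Bdd B)
    (i₀ : Fin (m + 1)) (i : Fin m) : (didilStep E₀ G i₀ i).Bdd (20 * B) :=
  ExactTerm.bdd_didil hE (hG _) (hG _)


/-! ### Constant terms of form products; explicit numerator / denominator of a term -/

/-- `coeff_zero_formProd` (API of the exact DiDIL objects). [cite: DuttaDwivediSaxena2022, Def. 3.1 and §2.3 (`ΠΣ` = products of affine forms, `Σ∧Σ`), full version p0026 L702–707, p0020 L537–540] -/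
theorem coeff_zero_formProd (L : List (Option (Fin n) → K)) :
    coeff 0 (formProd L) = (L.map fun a => a none).prod := by
  induction L with
  | nil => simp
  | cons a L ih =>
    rw [formProd_cons, List.map_cons, List.prod_cons, ← ih, ← coeff_zero_affForm a]
    simp only [← constantCoeff_eq, map_mul]

/-- `coeff_zero_formProd_ne_zero` (API of the exact DiDIL objects). [cite: DuttaDwivediSaxena2022, Def. 3.1 and §2.3 (`ΠΣ` = products of affine forms, `Σ∧Σ`), full version p0026 L702–707, p0020 L537–540] -/
theorem coeff_zero_formProd_ne_zero {L : List (Option (Fin n) → K)} (hL : ∀ a ∈ L, a none ≠ 0) :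
    coeff 0 (formProd L) ≠ 0 := by
  rw [coeff_zero_formProd]
  exact List.prod_ne_zero fun h => by
    obtain ⟨a, ha, ha0⟩ := List.mem_map.1 h
    exact hL a ha ha0

namespace FracPair

/-- `coeff_zero_den_ne_zero` (API of the exact DiDIL objects). [cite: DuttaDwivediSaxena2022, §3 proof of Thm. 3.2, the terms `(U/V)·(P/Q)` of the DiDIL induction and Claim 3.6 (full version p0030 L801–805, p0031 L836–845, p0032 L848–850)] -/
theorem coeff_zero_den_ne_zero (P : FracPair K n) : coeff 0 P.den ≠ 0 :=
  coeff_zero_formProd_ne_zero P.hL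

end FracPair

namespace ExactTerm

/-- The explicit numerator polynomial `κ · ∏num · p · ∏L_𝒬` of `T = A·𝒫/𝒬`.
[cite: DuttaDwivediSaxena2022, §3 proof of Thm. 3.2, the terms `(U/V)·(P/Q)` of the DiDIL induction and Claim 3.6 (full version p0030 L801–805, p0031 L836–845, p0032 L848–850)] -/
def numPoly (T : ExactTerm K n) : MvPolynomial (Fin n) K :=
  C T.A.κ * formProd T.A.num * T.P.p * T.Q.den

/-- The explicit denominator polynomial `∏den · q · ∏L_𝒫` of `T = A·𝒫/𝒬`.
[cite: DuttaDwivediSaxena2022, §3 proof of Thm. 3.2, the terms `(U/V)·(P/Q)` of the DiDIL induction and Claim 3.6 (full version p0030 L801–805, p0031 L836–845, p0032 L848–850)] -/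
def denPoly (T : ExactTerm K n) : MvPolynomial (Fin n) K :=
  formProd T.A.den * T.Q.p * T.P.den

/-- `denPoly_ne_zero` (API of the exact DiDIL objects). [cite: DuttaDwivediSaxena2022, §3 proof of Thm. 3.2, the terms `(U/V)·(P/Q)` of the DiDIL induction and Claim 3.6 (full version p0030 L801–805, p0031 L836–845, p0032 L848–850)] -/
theorem denPoly_ne_zero (T : ExactTerm K n) (hT : T.WF) : T.denPoly ≠ 0 :=
  mul_ne_zero (mul_ne_zero (formProd_ne_zero T.A.hden) hT) T.P.den_ne_zero

/-- `numPoly_ne_zero` (API of the exact DiDIL objects). [cite: DuttaDwivediSaxena2022, §3 proof of Thm. 3.2, the terms `(U/V)·(P/Q)` of the DiDIL induction and Claim 3.6 (full version p0030 L801–805, p0031 L836–845, p0032 L848–850)] -/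
theorem numPoly_ne_zero (T : ExactTerm K n) (hT : T.ND) : T.numPoly ≠ 0 :=
  mul_ne_zero (mul_ne_zero (mul_ne_zero (C_eq_zero.not.2 T.A.hκ) (formProd_ne_zero T.A.hnum)) hT)
    T.Q.den_ne_zero

/-- `val_eq_numPoly_div_denPoly` (API of the exact DiDIL objects). [cite: DuttaDwivediSaxena2022, §3 proof of Thm. 3.2, the terms `(U/V)·(P/Q)` of the DiDIL induction and Claim 3.6 (full version p0030 L801–805, p0031 L836–845, p0032 L848–850)] -/
theorem val_eq_numPoly_div_denPoly (T : ExactTerm K n) (hT : T.WF) :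
    T.val = algebraMap (MvPolynomial (Fin n) K) (FractionRing (MvPolynomial (Fin n) K)) T.numPoly /
      algebraMap (MvPolynomial (Fin n) K) (FractionRing (MvPolynomial (Fin n) K)) T.denPoly := by
  have h1 := T.A.algebraMap_den_ne_zero
  have h2 := T.P.algebraMap_den_ne_zero
  have h3 := T.Q.algebraMap_den_ne_zero
  have h4 : algebraMap (MvPolynomial (Fin n) K) (FractionRing (MvPolynomial (Fin n) K)) T.Q.p ≠ 0 :=
    fun h => hT ((IsFractionRing.injective _ _) (by rw [h, map_zero]))
  simp only [val, numPoly, denPoly, PiRatio.val, FracPair.val, map_mul]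
  field_simp

/-- The cleared identity `val T · denPoly = numPoly` (no well-formedness needed when stated as
`numPoly = val · denPoly` would fail; we state the division-free consequence under `WF`).
[cite: DuttaDwivediSaxena2022, §3 proof of Thm. 3.2, the terms `(U/V)·(P/Q)` of the DiDIL induction and Claim 3.6 (full version p0030 L801–805, p0031 L836–845, p0032 L848–850)] -/
theorem val_mul_denPoly (T : ExactTerm K n) (hT : T.WF) :
    T.val * algebraMap (MvPolynomial (Fin n) K) (FractionRing (MvPolynomial (Fin n) K)) T.denPoly =
      algebraMap (MvPolynomial (Fin n) K) (FractionRing (MvPolynomial (Fin n) K)) T.numPoly := by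
  have h : algebraMap (MvPolynomial (Fin n) K) (FractionRing (MvPolynomial (Fin n) K)) T.denPoly ≠ 0 :=
    fun h => (T.denPoly_ne_zero hT) ((IsFractionRing.injective _ _) (by rw [h, map_zero]))
  rw [T.val_eq_numPoly_div_denPoly hT, div_mul_cancel₀ _ h]

end ExactTerm


/-! ### The Euler operator `euler (Fin n) K` of `DDS21GradedFractions.lean` on affine forms -/

/-- The Euler operator does not raise total degrees (`coeff d (E p) = |d| · coeff d p`).
[cite: DuttaDwivediSaxena2022, Def. 3.1 and §2.3 (`ΠΣ` = products of affine forms, `Σ∧Σ`), full version p0026 L702–707, p0020 L537–540] -/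
theorem degLE_euler : DegLE (euler (Fin n) K) := by
  classical
  intro p
  refine Finset.sup_mono fun d hd => ?_
  rw [mem_support_iff] at hd ⊢
  rw [coeff_euler] at hd
  exact right_ne_zero_of_mul hd

/-- `isHomogeneous_linPart` (API of the exact DiDIL objects). [cite: DuttaDwivediSaxena2022, Def. 3.1 and §2.3 (`ΠΣ` = products of affine forms, `Σ∧Σ`), full version p0026 L702–707, p0020 L537–540] -/
theorem isHomogeneous_linPart (a : Option (Fin n) → K) : (linPart a).IsHomogeneous 1 := by
  refine IsHomogeneous.sum _ _ _ fun m _ => ?_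
  simpa using (isHomogeneous_C _ (a (some m))).mul (isHomogeneous_X K m)

/-- `E(affForm a) = linPart a`: the Euler operator kills the constant and fixes the linear part.
[cite: DuttaDwivediSaxena2022, Def. 3.1 and §2.3 (`ΠΣ` = products of affine forms, `Σ∧Σ`), full version p0026 L702–707, p0020 L537–540] -/
theorem euler_affForm (a : Option (Fin n) → K) : euler (Fin n) K (affForm a) = linPart a := by
  rw [affForm_eq, map_add, euler_C, zero_add, euler_of_isHomogeneous (isHomogeneous_linPart a),
    Nat.cast_one, one_smul]

/-- `euler_linPart` (API of the exact DiDIL objects). [cite: DuttaDwivediSaxena2022, Def. 3.1 and §2.3 (`ΠΣ` = products of affine forms, `Σ∧Σ`), full version p0026 L702–707, p0020 L537–540] -/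
theorem euler_linPart (a : Option (Fin n) → K) : euler (Fin n) K (linPart a) = linPart a := by
  rw [euler_of_isHomogeneous (isHomogeneous_linPart a), Nat.cast_one, one_smul]

/-! ### Convolution sums stay in `Σ∧Σ` (budget arithmetic for graded components of products) -/

/-- If `u_a ∈ Σ∧Σ(t₁, a)` and `v_b ∈ Σ∧Σ(t₂, b)` for all `a, b ≤ c`, then the convolution
`∑_{a+b=c} u_a v_b ∈ Σ∧Σ((c+1)·t₁t₂(c+1), c)` (Lemma 2.12 termwise, then closure under sums).
[cite: DuttaDwivediSaxena2022, §3 proof of Thm. 3.2, Claim 3.6: `dlog(Σ) ∈ Σ∧Σ`, Lemmas 2.12/2.15 coefficientwise (full version p0032 L854 – p0033 L887; Lemma 2.12 p0020 L549–555, Lemma 2.15 p0021 L578–583)] -/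
theorem sum_antidiagonal_mul_mem_swsClass [CharZero K] {t₁ t₂ c : ℕ}
    {u v : ℕ → MvPolynomial (Fin n) K} (hu : ∀ a ≤ c, u a ∈ swsClass K n t₁ a)
    (hv : ∀ b ≤ c, v b ∈ swsClass K n t₂ b) :
    ∑ x ∈ antidiagonal c, u x.1 * v x.2 ∈
      swsClass K n ((c + 1) * (t₁ * t₂ * (c + 1))) c := by
  have hcard : (antidiagonal c).card = c + 1 :=
    Finset.Nat.card_antidiagonal c
  have h := sum_mem_swsClass (antidiagonal c) (fun x => u x.1 * v x.2)
    (t := t₁ * t₂ * (c + 1)) (e := c) fun x hx => by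
      have hx' : x.1 + x.2 = c := mem_antidiagonal.1 hx
      have h := mul_mem_swsClass (hu x.1 (by omega)) (hv x.2 (by omega))
      rw [hx'] at h
      exact h
  rwa [hcard] at h


/-! ### `Σ∧Σ` certificates for the graded pieces of the fractions (via `gcomp` of
`DDS21GradedFractions.lean`) and their propagation through the DiDIL step -/

namespace FracPair

/-- The degree-`c` graded piece of the power series `p / den`.
[cite: DuttaDwivediSaxena2022, §3 proof of Thm. 3.2, Claim 3.6: `dlog(Σ) ∈ Σ∧Σ`, Lemmas 2.12/2.15 coefficientwise (full version p0032 L854 – p0033 L887; Lemma 2.12 p0020 L549–555, Lemma 2.15 p0021 L578–583)] -/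
def gc (P : FracPair K n) (c : ℕ) : MvPolynomial (Fin n) K := gcomp P.p P.den c

/-- `gc_def` (API of the exact DiDIL objects). [cite: DuttaDwivediSaxena2022, §3 proof of Thm. 3.2, Claim 3.6: `dlog(Σ) ∈ Σ∧Σ`, Lemmas 2.12/2.15 coefficientwise (full version p0032 L854 – p0033 L887; Lemma 2.12 p0020 L549–555, Lemma 2.15 p0021 L578–583)] -/
theorem gc_def (P : FracPair K n) (c : ℕ) : P.gc c = gcomp P.p P.den c := rfl

/-- `Σ∧Σ` certificate of precision `N` and top fan-in `t`: every graded piece of degree `c < N` of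
`p / den` is a `Σ∧Σ` circuit with `≤ t` summands and exponents `≤ c`.
[cite: DuttaDwivediSaxena2022, §3 proof of Thm. 3.2, Claim 3.6: `dlog(Σ) ∈ Σ∧Σ`, Lemmas 2.12/2.15 coefficientwise (full version p0032 L854 – p0033 L887; Lemma 2.12 p0020 L549–555, Lemma 2.15 p0021 L578–583)] -/
def Cert (N t : ℕ) (P : FracPair K n) : Prop :=
  ∀ c < N, P.gc c ∈ swsClass K n t c

/-- `Cert.mono` (API of the exact DiDIL objects). [cite: DuttaDwivediSaxena2022, §3 proof of Thm. 3.2, Claim 3.6: `dlog(Σ) ∈ Σ∧Σ`, Lemmas 2.12/2.15 coefficientwise (full version p0032 L854 – p0033 L887; Lemma 2.12 p0020 L549–555, Lemma 2.15 p0021 L578–583)] -/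
theorem Cert.mono {N t t' : ℕ} {P : FracPair K n} (h : P.Cert N t) (ht : t ≤ t') : P.Cert N t' :=
  fun c hc => swsClass_mono ht le_rfl (h c hc)

/-- `Cert.anti` (API of the exact DiDIL objects). [cite: DuttaDwivediSaxena2022, §3 proof of Thm. 3.2, Claim 3.6: `dlog(Σ) ∈ Σ∧Σ`, Lemmas 2.12/2.15 coefficientwise (full version p0032 L854 – p0033 L887; Lemma 2.12 p0020 L549–555, Lemma 2.15 p0021 L578–583)] -/
theorem Cert.anti {N N' t : ℕ} {P : FracPair K n} (h : P.Cert N t) (hN : N' ≤ N) : P.Cert N' t :=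
  fun c hc => h c (lt_of_lt_of_le hc hN)

/-- `gc_mul` (API of the exact DiDIL objects). [cite: DuttaDwivediSaxena2022, §3 proof of Thm. 3.2, Claim 3.6: `dlog(Σ) ∈ Σ∧Σ`, Lemmas 2.12/2.15 coefficientwise (full version p0032 L854 – p0033 L887; Lemma 2.12 p0020 L549–555, Lemma 2.15 p0021 L578–583)] -/
theorem gc_mul (P Q : FracPair K n) (c : ℕ) :
    (P.mul Q).gc c = ∑ ij ∈ antidiagonal c, P.gc ij.1 * Q.gc ij.2 := by
  rw [gc_def, mul_p, den_mul, gcomp_mul]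
  rfl

/-- `Cert.mul` (API of the exact DiDIL objects). [cite: DuttaDwivediSaxena2022, §3 proof of Thm. 3.2, Claim 3.6: `dlog(Σ) ∈ Σ∧Σ`, Lemmas 2.12/2.15 coefficientwise (full version p0032 L854 – p0033 L887; Lemma 2.12 p0020 L549–555, Lemma 2.15 p0021 L578–583)] -/
theorem Cert.mul [CharZero K] {N t₁ t₂ : ℕ} {P Q : FracPair K n} (hP : P.Cert N t₁)
    (hQ : Q.Cert N t₂) : (P.mul Q).Cert N (N * (t₁ * t₂ * N)) := by
  intro c hc
  rw [gc_mul]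
  refine swsClass_mono ?_ le_rfl
    (sum_antidiagonal_mul_mem_swsClass (fun a ha => hP a (by omega)) (fun b hb => hQ b (by omega)))
  have h1 : c + 1 ≤ N := hc
  calc (c + 1) * (t₁ * t₂ * (c + 1)) ≤ N * (t₁ * t₂ * (c + 1)) := Nat.mul_le_mul_right _ h1
    _ ≤ N * (t₁ * t₂ * N) := Nat.mul_le_mul_left _ (Nat.mul_le_mul_left _ h1)

/-- `gc_add` (API of the exact DiDIL objects). [cite: DuttaDwivediSaxena2022, §3 proof of Thm. 3.2, Claim 3.6: `dlog(Σ) ∈ Σ∧Σ`, Lemmas 2.12/2.15 coefficientwise (full version p0032 L854 – p0033 L887; Lemma 2.12 p0020 L549–555, Lemma 2.15 p0021 L578–583)] -/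
theorem gc_add (P Q : FracPair K n) (c : ℕ) : (P.add Q).gc c = P.gc c + Q.gc c := by
  rw [gc_def, add_p, den_add, gcomp_add _ _ P.coeff_zero_den_ne_zero Q.coeff_zero_den_ne_zero]
  rfl

/-- `Cert.add` (API of the exact DiDIL objects). [cite: DuttaDwivediSaxena2022, §3 proof of Thm. 3.2, Claim 3.6: `dlog(Σ) ∈ Σ∧Σ`, Lemmas 2.12/2.15 coefficientwise (full version p0032 L854 – p0033 L887; Lemma 2.12 p0020 L549–555, Lemma 2.15 p0021 L578–583)] -/
theorem Cert.add {N t₁ t₂ : ℕ} {P Q : FracPair K n} (hP : P.Cert N t₁) (hQ : Q.Cert N t₂) :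
    (P.add Q).Cert N (t₁ + t₂) := by
  intro c hc
  rw [gc_add]
  exact add_mem_swsClass' (hP c hc) (hQ c hc)

/-- `gc_neg` (API of the exact DiDIL objects). [cite: DuttaDwivediSaxena2022, §3 proof of Thm. 3.2, Claim 3.6: `dlog(Σ) ∈ Σ∧Σ`, Lemmas 2.12/2.15 coefficientwise (full version p0032 L854 – p0033 L887; Lemma 2.12 p0020 L549–555, Lemma 2.15 p0021 L578–583)] -/
theorem gc_neg (P : FracPair K n) (c : ℕ) : P.neg.gc c = -P.gc c := by
  rw [gc_def, neg_p, den_neg, gcomp_neg_left]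
  rfl

/-- `Cert.neg` (API of the exact DiDIL objects). [cite: DuttaDwivediSaxena2022, §3 proof of Thm. 3.2, Claim 3.6: `dlog(Σ) ∈ Σ∧Σ`, Lemmas 2.12/2.15 coefficientwise (full version p0032 L854 – p0033 L887; Lemma 2.12 p0020 L549–555, Lemma 2.15 p0021 L578–583)] -/
theorem Cert.neg {N t : ℕ} {P : FracPair K n} (hP : P.Cert N t) : P.neg.Cert N t := by
  intro c hc
  rw [gc_neg]
  exact neg_mem_swsClass (hP c hc)

/-- `Cert.sub` (API of the exact DiDIL objects). [cite: DuttaDwivediSaxena2022, §3 proof of Thm. 3.2, Claim 3.6: `dlog(Σ) ∈ Σ∧Σ`, Lemmas 2.12/2.15 coefficientwise (full version p0032 L854 – p0033 L887; Lemma 2.12 p0020 L549–555, Lemma 2.15 p0021 L578–583)] -/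
theorem Cert.sub {N t₁ t₂ : ℕ} {P Q : FracPair K n} (hP : P.Cert N t₁) (hQ : Q.Cert N t₂) :
    (P.sub Q).Cert N (t₁ + t₂) :=
  Cert.add hP hQ.neg

/-- `gc_smul` (API of the exact DiDIL objects). [cite: DuttaDwivediSaxena2022, §3 proof of Thm. 3.2, Claim 3.6: `dlog(Σ) ∈ Σ∧Σ`, Lemmas 2.12/2.15 coefficientwise (full version p0032 L854 – p0033 L887; Lemma 2.12 p0020 L549–555, Lemma 2.15 p0021 L578–583)] -/
theorem gc_smul (a : K) (P : FracPair K n) (c : ℕ) : (P.smul a).gc c = a • P.gc c := by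
  rw [gc_def, smul_p, den_smul, gcomp_C_mul]
  rfl

/-- `Cert.smul` (API of the exact DiDIL objects). [cite: DuttaDwivediSaxena2022, §3 proof of Thm. 3.2, Claim 3.6: `dlog(Σ) ∈ Σ∧Σ`, Lemmas 2.12/2.15 coefficientwise (full version p0032 L854 – p0033 L887; Lemma 2.12 p0020 L549–555, Lemma 2.15 p0021 L578–583)] -/
theorem Cert.smul {N t : ℕ} (a : K) {P : FracPair K n} (hP : P.Cert N t) : (P.smul a).Cert N t := by
  intro c hc
  rw [gc_smul, smul_eq_C_mul]
  exact C_mul_mem_swsClass a (hP c hc)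

/-- Graded pieces of `E(p/den)`: `E` is diagonal of weight `c` in degree `c`.
[cite: DuttaDwivediSaxena2022, §3 proof of Thm. 3.2, Claim 3.6: `dlog(Σ) ∈ Σ∧Σ`, Lemmas 2.12/2.15 coefficientwise (full version p0032 L854 – p0033 L887; Lemma 2.12 p0020 L549–555, Lemma 2.15 p0021 L578–583)] -/
theorem gc_der_euler (P : FracPair K n) (c : ℕ) :
    (P.der (euler (Fin n) K)).gc c = (c : K) • P.gc c := by
  rw [gc_def, der_p, den_der, ← pow_two, gcomp_euler _ P.coeff_zero_den_ne_zero]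
  rfl

/-- `Cert.der_euler` (API of the exact DiDIL objects). [cite: DuttaDwivediSaxena2022, §3 proof of Thm. 3.2, Claim 3.6: `dlog(Σ) ∈ Σ∧Σ`, Lemmas 2.12/2.15 coefficientwise (full version p0032 L854 – p0033 L887; Lemma 2.12 p0020 L549–555, Lemma 2.15 p0021 L578–583)] -/
theorem Cert.der_euler {N t : ℕ} {P : FracPair K n} (hP : P.Cert N t) :
    (P.der (euler (Fin n) K)).Cert N t := by
  intro c hc
  rw [gc_der_euler, smul_eq_C_mul]
  exact C_mul_mem_swsClass _ (hP c hc)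

/-- The polynomial `1` has pieces `1, 0, 0, …`.
[cite: DuttaDwivediSaxena2022, §3 proof of Thm. 3.2, Claim 3.6: `dlog(Σ) ∈ Σ∧Σ`, Lemmas 2.12/2.15 coefficientwise (full version p0032 L854 – p0033 L887; Lemma 2.12 p0020 L549–555, Lemma 2.15 p0021 L578–583)] -/
theorem gc_ofPoly_one (c : ℕ) :
    (ofPoly (1 : MvPolynomial (Fin n) K)).gc c = if c = 0 then 1 else 0 := by
  rw [gc_def, den_ofPoly, ofPoly_p, gcomp_one]
  rcases Nat.eq_zero_or_pos c with rfl | hc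
  · simp [homogeneousComponent_zero]
  · rw [if_neg hc.ne', homogeneousComponent_eq_zero]
    rw [totalDegree_one]
    exact hc

/-- `cert_ofPoly_one` (API of the exact DiDIL objects). [cite: DuttaDwivediSaxena2022, §3 proof of Thm. 3.2, Claim 3.6: `dlog(Σ) ∈ Σ∧Σ`, Lemmas 2.12/2.15 coefficientwise (full version p0032 L854 – p0033 L887; Lemma 2.12 p0020 L549–555, Lemma 2.15 p0021 L578–583)] -/
theorem cert_ofPoly_one (N : ℕ) : (ofPoly (1 : MvPolynomial (Fin n) K)).Cert N 1 := by
  intro c _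
  rw [gc_ofPoly_one]
  split_ifs
  · exact swsClass_mono le_rfl (Nat.zero_le _) one_mem_swsClass
  · exact zero_mem_swsClass 1 c

end FracPair


/-! ### Certificates for `dlog` of form products: eq. (3.3) summed over the forms -/

/-- The graded pieces of `E(∏_L ℓ)/∏_L ℓ = ∑_{ℓ ∈ L} Eℓ/ℓ` are sums of `|L|` powers of linear forms:
`gcomp (E Π_L) Π_L c ∈ Σ∧Σ(|L|, c)` (eq. (3.3) for each form, `gcomp_linear_affine`).
[cite: DuttaDwivediSaxena2022, §3 proof of Thm. 3.2, eq. (3.3) and "dlog distributes the product additively … dlog(ΠΣ/ΠΣ) ∈ Σ dlog(Σ)" (full version p0031 L836–838, p0032 L854–862, p0033 L873–877)] -/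
theorem gcomp_euler_formProd_mem_swsClass {L : List (Option (Fin n) → K)} (hL : ∀ a ∈ L, a none ≠ 0)
    (c : ℕ) : gcomp (euler (Fin n) K (formProd L)) (formProd L) c ∈ swsClass K n L.length c := by
  induction L with
  | nil =>
    have h0 : euler (Fin n) K (formProd ([] : List (Option (Fin n) → K))) = 0 := by
      rw [formProd_nil]; exact (euler (Fin n) K).map_one_eq_zero
    rw [h0, gcomp_zero]
    exact zero_mem_swsClass _ _
  | cons a L ih =>
    have ha : a none ≠ 0 := hL a (by simp)
    have hL' : ∀ b ∈ L, b none ≠ 0 := fun b hb => hL b (by simp [hb])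
    have hℓ : coeff 0 (affForm a) ≠ 0 := by rwa [coeff_zero_affForm]
    have hP0 : coeff 0 (formProd L) ≠ 0 := coeff_zero_formProd_ne_zero hL'
    rw [formProd_cons, euler_mul, mul_comm (affForm a) (euler (Fin n) K (formProd L)),
      gcomp_add _ _ hℓ hP0, List.length_cons, Nat.add_comm]
    refine add_mem_swsClass' ?_ (ih hL')
    rw [euler_affForm, affForm_eq, gcomp_linear_affine ha (isHomogeneous_linPart a)]
    split_ifs with hc
    · exact zero_mem_swsClass _ _
    · have h := C_mul_affinePow_mem_swsClass (n := n) (t := 1) (e := c) (k := c) le_rfl le_rfl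
        (-(-(a none)⁻¹) ^ c) (fun o => o.elim 0 fun m => a (some m))
      simp only [Option.elim, C_0, zero_add] at h
      exact h

namespace PiRatio

/-- `cert_dlog` (API of the exact DiDIL objects). [cite: DuttaDwivediSaxena2022, §3 proof of Thm. 3.2, eq. (3.3) and "dlog distributes the product additively … dlog(ΠΣ/ΠΣ) ∈ Σ dlog(Σ)" (full version p0031 L836–838, p0032 L854–862, p0033 L873–877)] -/
theorem cert_dlog (A : PiRatio K n) (N : ℕ) :
    (A.dlog (euler (Fin n) K)).Cert N (A.num.length + A.den.length) := by
  refine FracPair.Cert.sub (P := ⟨euler (Fin n) K (formProd A.num), A.num, A.hnum⟩)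
    (Q := ⟨euler (Fin n) K (formProd A.den), A.den, A.hden⟩) ?_ ?_
  · intro c _; exact gcomp_euler_formProd_mem_swsClass A.hnum c
  · intro c _; exact gcomp_euler_formProd_mem_swsClass A.hden c

end PiRatio

/-! ### Certificates of exact terms and their propagation through the DiDIL step -/

namespace ExactTerm

/-- `Σ∧Σ` certificate of an exact term: both fractions `𝒫, 𝒬` have `Σ∧Σ(t, c)` graded pieces in
all degrees `c < N`.
[cite: DuttaDwivediSaxena2022, §3 proof of Thm. 3.2, Claim 3.6: `dlog(Σ) ∈ Σ∧Σ`, Lemmas 2.12/2.15 coefficientwise (full version p0032 L854 – p0033 L887; Lemma 2.12 p0020 L549–555, Lemma 2.15 p0021 L578–583)] -/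
def Cert (N t : ℕ) (T : ExactTerm K n) : Prop := T.P.Cert N t ∧ T.Q.Cert N t

/-- `Cert.mono` (API of the exact DiDIL objects). [cite: DuttaDwivediSaxena2022, §3 proof of Thm. 3.2, Claim 3.6: `dlog(Σ) ∈ Σ∧Σ`, Lemmas 2.12/2.15 coefficientwise (full version p0032 L854 – p0033 L887; Lemma 2.12 p0020 L549–555, Lemma 2.15 p0021 L578–583)] -/
theorem Cert.mono {N t t' : ℕ} {T : ExactTerm K n} (h : T.Cert N t) (ht : t ≤ t') : T.Cert N t' :=
  ⟨h.1.mono ht, h.2.mono ht⟩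

/-- `cert_ofForms` (API of the exact DiDIL objects). [cite: DuttaDwivediSaxena2022, §3 proof of Thm. 3.2, Claim 3.6: `dlog(Σ) ∈ Σ∧Σ`, Lemmas 2.12/2.15 coefficientwise (full version p0032 L854 – p0033 L887; Lemma 2.12 p0020 L549–555, Lemma 2.15 p0021 L578–583)] -/
theorem cert_ofForms (κ : K) (hκ : κ ≠ 0) (L : List (Option (Fin n) → K))
    (hL : ∀ a ∈ L, a none ≠ 0) (N : ℕ) : (ofForms κ hκ L hL).Cert N 1 :=
  ⟨FracPair.cert_ofPoly_one N, FracPair.cert_ofPoly_one N⟩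

/-- `Cert.smul` (API of the exact DiDIL objects). [cite: DuttaDwivediSaxena2022, §3 proof of Thm. 3.2, Claim 3.6: `dlog(Σ) ∈ Σ∧Σ`, Lemmas 2.12/2.15 coefficientwise (full version p0032 L854 – p0033 L887; Lemma 2.12 p0020 L549–555, Lemma 2.15 p0021 L578–583)] -/
theorem Cert.smul {N t : ℕ} (c : K) (hc : c ≠ 0) {T : ExactTerm K n} (h : T.Cert N t) :
    (T.smul c hc).Cert N t := h

/-- `Cert.divT` (API of the exact DiDIL objects). [cite: DuttaDwivediSaxena2022, §3 proof of Thm. 3.2, Claim 3.6: `dlog(Σ) ∈ Σ∧Σ`, Lemmas 2.12/2.15 coefficientwise (full version p0032 L854 – p0033 L887; Lemma 2.12 p0020 L549–555, Lemma 2.15 p0021 L578–583)] -/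
theorem Cert.divT [CharZero K] {N t : ℕ} {T S : ExactTerm K n} (hT : T.Cert N t) (hS : S.Cert N t) :
    (T.divT S).Cert N (N ^ 2 * t ^ 2) := by
  have e : N * (t * t * N) = N ^ 2 * t ^ 2 := by ring
  exact ⟨e ▸ hT.1.mul hS.2, e ▸ hT.2.mul hS.1⟩

/-- `Cert.derT` (API of the exact DiDIL objects). [cite: DuttaDwivediSaxena2022, §3 proof of Thm. 3.2, Claim 3.6: `dlog(Σ) ∈ Σ∧Σ`, Lemmas 2.12/2.15 coefficientwise (full version p0032 L854 – p0033 L887; Lemma 2.12 p0020 L549–555, Lemma 2.15 p0021 L578–583)] -/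
theorem Cert.derT [CharZero K] {N t B : ℕ} {T : ExactTerm K n} (hT : T.Cert N t) (hB : T.Bdd B) :
    (T.derT (euler (Fin n) K)).Cert N ((2 * B + 2) * N ^ 4 * t ^ 2) := by
  obtain ⟨hP, hQ⟩ := hT
  obtain ⟨h1, h2, -, -, -, -⟩ := hB
  have hdl : (T.A.dlog (euler (Fin n) K)).Cert N (2 * B) :=
    (T.A.cert_dlog N).mono (by omega)
  have hPQ : (T.P.mul T.Q).Cert N (N * (t * t * N)) := hP.mul hQ
  have hA : ((T.A.dlog (euler (Fin n) K)).mul (T.P.mul T.Q)).Cert N (N * (2 * B * (N * (t * t * N)) * N)) :=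
    hdl.mul hPQ
  have hB1 : ((T.P.der (euler (Fin n) K)).mul T.Q).Cert N (N * (t * t * N)) := hP.der_euler.mul hQ
  have hB2 : (T.P.mul (T.Q.der (euler (Fin n) K))).Cert N (N * (t * t * N)) := hP.mul hQ.der_euler
  have hnum := hA.add (hB1.sub hB2)
  have hden : (T.Q.mul T.Q).Cert N (N * (t * t * N)) := hQ.mul hQ
  have hle1 : N * (2 * B * (N * (t * t * N)) * N) + (N * (t * t * N) + N * (t * t * N)) ≤
      (2 * B + 2) * N ^ 4 * t ^ 2 := by
    have hN : N ^ 2 * t ^ 2 ≤ N ^ 4 * t ^ 2 := by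
      rcases Nat.eq_zero_or_pos N with rfl | hN
      · simp
      · exact Nat.mul_le_mul_right _ (Nat.pow_le_pow_right hN (by norm_num))
    calc N * (2 * B * (N * (t * t * N)) * N) + (N * (t * t * N) + N * (t * t * N))
        = 2 * B * (N ^ 4 * t ^ 2) + 2 * (N ^ 2 * t ^ 2) := by ring
      _ ≤ 2 * B * (N ^ 4 * t ^ 2) + 2 * (N ^ 4 * t ^ 2) := by omega
      _ = (2 * B + 2) * N ^ 4 * t ^ 2 := by ring
  have hle2 : N * (t * t * N) ≤ (2 * B + 2) * N ^ 4 * t ^ 2 := le_trans (by omega) hle1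
  exact ⟨hnum.mono hle1, hden.mono hle2⟩

/-- `Cert.didil` (API of the exact DiDIL objects). [cite: DuttaDwivediSaxena2022, §3 proof of Thm. 3.2, Claim 3.6: `dlog(Σ) ∈ Σ∧Σ`, Lemmas 2.12/2.15 coefficientwise (full version p0032 L854 – p0033 L887; Lemma 2.12 p0020 L549–555, Lemma 2.15 p0021 L578–583)] -/
theorem Cert.didil [CharZero K] {N t B : ℕ} {T S : ExactTerm K n} (hT : T.Cert N t) (hS : S.Cert N t)
    (hTB : T.Bdd B) (hSB : S.Bdd B) :
    (didil (euler (Fin n) K) T S).Cert N ((4 * B + 2) * N ^ 8 * t ^ 4) := by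
  have h := Cert.derT (hT.divT hS) (bdd_divT hTB hSB)
  have e : (2 * (2 * B) + 2) * N ^ 4 * (N ^ 2 * t ^ 2) ^ 2 = (4 * B + 2) * N ^ 8 * t ^ 4 := by ring
  rw [e] at h
  exact h

end ExactTerm

/-- `cert_didilStep` (API of the exact DiDIL objects). [cite: DuttaDwivediSaxena2022, §3 proof of Thm. 3.2, Claim 3.6: `dlog(Σ) ∈ Σ∧Σ`, Lemmas 2.12/2.15 coefficientwise (full version p0032 L854 – p0033 L887; Lemma 2.12 p0020 L549–555, Lemma 2.15 p0021 L578–583)] -/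
theorem cert_didilStep [CharZero K] {N t B m : ℕ} {G : Fin (m + 1) → ExactTerm K n}
    (hG : ∀ i, (G i).Cert N t) (hB : ∀ i, (G i).Bdd B) (i₀ : Fin (m + 1)) (i : Fin m) :
    (didilStep (euler (Fin n) K) G i₀ i).Cert N ((4 * B + 2) * N ^ 8 * t ^ 4) :=
  ExactTerm.Cert.didil (hG _) (hG _) (hB _) (hB _)

/-! ### The Euler instance of the exact identity -/

/-- `extendsDer_eulerFrac` (API of the exact DiDIL objects). [cite: DuttaDwivediSaxena2022, §3 proof of Thm. 3.2, Divide and Derive, eq. (3.2) and `T_{i,j+1} := (T_{i,j}/T̃_{k-j,j})·dlog(T_{i,j}/T̃_{k-j,j})` (full version p0030 L808–812, p0031 L815–817)] -/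
theorem extendsDer_eulerFrac :
    ExtendsDer K n (euler (Fin n) K) (eulerFrac (Fin n) K (FractionRing (MvPolynomial (Fin n) K))) :=
  fun p => eulerFrac_algebraMap p

/-- **DiDIL step, Euler form (DDS21 eq. (3.2) exact, in the graded frame)**:
`Σ_{i ≠ i₀} E(T_i/T_{i₀}) = E((Σ_i T_i)/T_{i₀})` for the Euler derivation of `K(x)`.
[cite: DuttaDwivediSaxena2022, §3 proof of Thm. 3.2, Divide and Derive, eq. (3.2) and `T_{i,j+1} := (T_{i,j}/T̃_{k-j,j})·dlog(T_{i,j}/T̃_{k-j,j})` (full version p0030 L808–812, p0031 L815–817)] -/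
theorem sum_val_didilStep_euler {m : ℕ} (G : Fin (m + 1) → ExactTerm K n) (hG : ∀ i, (G i).WF)
    (i₀ : Fin (m + 1)) (h : (G i₀).ND) :
    ∑ i, (didilStep (euler (Fin n) K) G i₀ i).val =
      eulerFrac (Fin n) K (FractionRing (MvPolynomial (Fin n) K)) ((∑ i, (G i).val) / (G i₀).val) :=
  sum_val_didilStep extendsDer_eulerFrac G hG i₀ h


/-! ### Iterating the step: `j` DiDIL rounds with a divisor-choice rule

By `ExactTerm.val_eq_zero_iff` any nonzero term may serve as the divisor (MEMO-t21g12 F6: the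
printed "minimal valuation" rule is vacuous generically). The rounds are driven by an arbitrary
CHOICE RULE `c m G : Fin (m+1)` (e.g. "the last index", or "some nondegenerate index"), so that the
indexing `Fin (m + j) → Fin m` stays free of casts. -/

/-- A divisor-choice rule: for every family of `m + 1` terms, the index to divide by.
[cite: DuttaDwivediSaxena2022, §3 proof of Thm. 3.2, the induction "Reducing Gen(k−j,·) to Gen(k−j−1,·)" over j = 0,…,k−2 and Claim 3.6 (full version p0030 L797–812, p0032 L848–850, p0033 L880–890)] -/
def Choice (K : Type*) [Field K] (n : ℕ) : Type _ :=
  ∀ m : ℕ, (Fin (m + 1) → ExactTerm K n) → Fin (m + 1)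

/-- The rule "divide by the last term".
[cite: DuttaDwivediSaxena2022, §3 proof of Thm. 3.2, the induction "Reducing Gen(k−j,·) to Gen(k−j−1,·)" over j = 0,…,k−2 and Claim 3.6 (full version p0030 L797–812, p0032 L848–850, p0033 L880–890)] -/
def Choice.last : Choice K n := fun m _ => Fin.last m

/-- `j` DiDIL rounds on a family of `m + j` exact terms under the choice rule `c`; the result has `m`
terms.
[cite: DuttaDwivediSaxena2022, §3 proof of Thm. 3.2, the induction "Reducing Gen(k−j,·) to Gen(k−j−1,·)" over j = 0,…,k−2 and Claim 3.6 (full version p0030 L797–812, p0032 L848–850, p0033 L880–890)] -/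
def didilIter (E₀ : Derivation K (MvPolynomial (Fin n) K) (MvPolynomial (Fin n) K)) (c : Choice K n)
    (m : ℕ) : (j : ℕ) → (Fin (m + j) → ExactTerm K n) → (Fin m → ExactTerm K n)
  | 0, G => G
  | j + 1, G => didilIter E₀ c m j (didilStep E₀ G (c (m + j) G))

/-- `didilIter_zero` (API of the DiDIL iteration). [cite: DuttaDwivediSaxena2022, §3 proof of Thm. 3.2, the induction "Reducing Gen(k−j,·) to Gen(k−j−1,·)" over j = 0,…,k−2 and Claim 3.6 (full version p0030 L797–812, p0032 L848–850, p0033 L880–890)] -/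
@[simp] theorem didilIter_zero (E₀ : Derivation K (MvPolynomial (Fin n) K) (MvPolynomial (Fin n) K))
    (c : Choice K n) (m : ℕ) (G : Fin (m + 0) → ExactTerm K n) : didilIter E₀ c m 0 G = G := rfl

/-- `didilIter_succ` (API of the DiDIL iteration). [cite: DuttaDwivediSaxena2022, §3 proof of Thm. 3.2, the induction "Reducing Gen(k−j,·) to Gen(k−j−1,·)" over j = 0,…,k−2 and Claim 3.6 (full version p0030 L797–812, p0032 L848–850, p0033 L880–890)] -/
theorem didilIter_succ (E₀ : Derivation K (MvPolynomial (Fin n) K) (MvPolynomial (Fin n) K))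
    (c : Choice K n) (m j : ℕ) (G : Fin (m + (j + 1)) → ExactTerm K n) :
    didilIter E₀ c m (j + 1) G = didilIter E₀ c m j (didilStep E₀ G (c (m + j) G)) := rfl

/-- The divisors chosen along the `j` rounds are all nondegenerate (every round is a genuine
"Divide and Derive").
[cite: DuttaDwivediSaxena2022, §3 proof of Thm. 3.2, the induction "Reducing Gen(k−j,·) to Gen(k−j−1,·)" over j = 0,…,k−2 and Claim 3.6 (full version p0030 L797–812, p0032 L848–850, p0033 L880–890)] -/
def DivisorsND (E₀ : Derivation K (MvPolynomial (Fin n) K) (MvPolynomial (Fin n) K)) (c : Choice K n)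
    (m : ℕ) : (j : ℕ) → (Fin (m + j) → ExactTerm K n) → Prop
  | 0, _ => True
  | j + 1, G => (G (c (m + j) G)).ND ∧ DivisorsND E₀ c m j (didilStep E₀ G (c (m + j) G))

/-- `wf_didilIter` (API of the DiDIL iteration). [cite: DuttaDwivediSaxena2022, §3 proof of Thm. 3.2, the induction "Reducing Gen(k−j,·) to Gen(k−j−1,·)" over j = 0,…,k−2 and Claim 3.6 (full version p0030 L797–812, p0032 L848–850, p0033 L880–890)] -/
theorem wf_didilIter (E₀ : Derivation K (MvPolynomial (Fin n) K) (MvPolynomial (Fin n) K))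
    (c : Choice K n) (m : ℕ) :
    ∀ (j : ℕ) (G : Fin (m + j) → ExactTerm K n), (∀ i, (G i).WF) → DivisorsND E₀ c m j G →
      ∀ i, (didilIter E₀ c m j G i).WF
  | 0, _, hG, _ => hG
  | j + 1, G, hG, hD => by
    rw [didilIter_succ]
    exact wf_didilIter E₀ c m j _ (fun i => wf_didilStep E₀ hG hD.1 i) hD.2

/-- Size tower: after `j` rounds the uniform bound is `20^j · B`.
[cite: DuttaDwivediSaxena2022, §3 proof of Thm. 3.2, the induction "Reducing Gen(k−j,·) to Gen(k−j−1,·)" over j = 0,…,k−2 and Claim 3.6 (full version p0030 L797–812, p0032 L848–850, p0033 L880–890)] -/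
theorem bdd_didilIter {E₀ : Derivation K (MvPolynomial (Fin n) K) (MvPolynomial (Fin n) K)}
    (hE : DegLE E₀) (c : Choice K n) (m : ℕ) :
    ∀ (j : ℕ) {B : ℕ} (G : Fin (m + j) → ExactTerm K n), (∀ i, (G i).Bdd B) →
      ∀ i, (didilIter E₀ c m j G i).Bdd (20 ^ j * B)
  | 0, B, G, hG, i => by simpa using hG i
  | j + 1, B, G, hG, i => by
    rw [didilIter_succ]
    have h := bdd_didilIter hE c m j (B := 20 * B) (didilStep E₀ G (c (m + j) G))
      (fun i => bdd_didilStep hE hG _ i) i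
    rw [pow_succ, mul_assoc]
    exact h.mono (le_of_eq (by ring))

/-- The certificate budget after `j` rounds, from initial fan-in `t` and size bound `B`:
`certTower N t B 0 = t`, `certTower N t B (j+1) = certTower N ((4B+2)N⁸t⁴) (20B) j`.
[cite: DuttaDwivediSaxena2022, §3 proof of Thm. 3.2, the induction "Reducing Gen(k−j,·) to Gen(k−j−1,·)" over j = 0,…,k−2 and Claim 3.6 (full version p0030 L797–812, p0032 L848–850, p0033 L880–890)] -/
def certTower (N : ℕ) : ℕ → ℕ → ℕ → ℕ
  | t, _, 0 => t
  | t, B, j + 1 => certTower N ((4 * B + 2) * N ^ 8 * t ^ 4) (20 * B) j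

/-- `certTower_zero` (API of the DiDIL iteration). [cite: DuttaDwivediSaxena2022, §3 proof of Thm. 3.2, the induction "Reducing Gen(k−j,·) to Gen(k−j−1,·)" over j = 0,…,k−2 and Claim 3.6 (full version p0030 L797–812, p0032 L848–850, p0033 L880–890)] -/
@[simp] theorem certTower_zero (N t B : ℕ) : certTower N t B 0 = t := rfl

/-- `certTower_succ` (API of the DiDIL iteration). [cite: DuttaDwivediSaxena2022, §3 proof of Thm. 3.2, the induction "Reducing Gen(k−j,·) to Gen(k−j−1,·)" over j = 0,…,k−2 and Claim 3.6 (full version p0030 L797–812, p0032 L848–850, p0033 L880–890)] -/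
theorem certTower_succ (N t B j : ℕ) :
    certTower N t B (j + 1) = certTower N ((4 * B + 2) * N ^ 8 * t ^ 4) (20 * B) j := rfl

/-- Certificate tower: after `j` rounds every term is certified with budget `certTower N t B j`.
[cite: DuttaDwivediSaxena2022, §3 proof of Thm. 3.2, the induction "Reducing Gen(k−j,·) to Gen(k−j−1,·)" over j = 0,…,k−2 and Claim 3.6 (full version p0030 L797–812, p0032 L848–850, p0033 L880–890)] -/
theorem cert_didilIter [CharZero K] (c : Choice K n) (m : ℕ) :
    ∀ (j : ℕ) {N t B : ℕ} (G : Fin (m + j) → ExactTerm K n), (∀ i, (G i).Cert N t) →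
      (∀ i, (G i).Bdd B) → ∀ i, (didilIter (euler (Fin n) K) c m j G i).Cert N (certTower N t B j)
  | 0, N, t, B, G, hG, _, i => by simpa [certTower] using hG i
  | j + 1, N, t, B, G, hG, hB, i => by
    rw [didilIter_succ]
    exact cert_didilIter c m j (didilStep (euler (Fin n) K) G (c (m + j) G))
      (fun i => cert_didilStep hG hB _ i) (fun i => bdd_didilStep degLE_euler hB _ i) i

/-- Values along the iteration, one round: the sum of the new family is `D` of the old sum divided
by the chosen divisor.
[cite: DuttaDwivediSaxena2022, §3 proof of Thm. 3.2, the induction "Reducing Gen(k−j,·) to Gen(k−j−1,·)" over j = 0,…,k−2 and Claim 3.6 (full version p0030 L797–812, p0032 L848–850, p0033 L880–890)] -/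
theorem sum_val_didilIter_succ {E₀ : Derivation K (MvPolynomial (Fin n) K) (MvPolynomial (Fin n) K)}
    {D : Derivation K (FractionRing (MvPolynomial (Fin n) K))
      (FractionRing (MvPolynomial (Fin n) K))}
    (hD : ExtendsDer K n E₀ D) (c : Choice K n) (m j : ℕ) (G : Fin (m + (j + 1)) → ExactTerm K n)
    (hG : ∀ i, (G i).WF) (h : (G (c (m + j) G)).ND) :
    ∑ i, (didilStep E₀ G (c (m + j) G) i).val = D ((∑ i, (G i).val) / (G (c (m + j) G)).val) :=
  sum_val_didilStep hD G hG _ h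

/-! ### Stage `0`: the live terms of a `Σ^{[k]}Π^{[d]}Σ` circuit as exact terms -/

/-- A product term `∏_j affForm (α j)` is LIVE if all its forms have nonzero constant terms (after the
generic shift every nonzero form does; a term with a zero form is zero and is dropped).
[cite: DuttaDwivediSaxena2022, §3 proof of Thm. 3.2, base case "define U_{i,0} := T_{i,0} and V_{i,0} := P_{i,0} := Q_{i,0} = 1" and "Φ(T_{i,0})|_{x=0} = T_{i,0}(α) ≠ 0" (full version p0028 L748–754)] -/
def LiveTerm {d : ℕ} (α : Fin d → Option (Fin n) → K) : Prop := ∀ j, (α j) none ≠ 0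

/-- A live product term as an exact term `1 · ∏_j ℓ_j` with `𝒫 = 𝒬 = 1`.
[cite: DuttaDwivediSaxena2022, §3 proof of Thm. 3.2, base case "define U_{i,0} := T_{i,0} and V_{i,0} := P_{i,0} := Q_{i,0} = 1" and "Φ(T_{i,0})|_{x=0} = T_{i,0}(α) ≠ 0" (full version p0028 L748–754)] -/
def ofLiveTerm {d : ℕ} (α : Fin d → Option (Fin n) → K) (h : LiveTerm α) : ExactTerm K n :=
  ExactTerm.ofForms 1 one_ne_zero (List.ofFn α) (fun a ha => by
    obtain ⟨j, rfl⟩ := List.mem_ofFn.1 ha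
    exact h j)

/-- `val_ofLiveTerm` (API of the DiDIL iteration). [cite: DuttaDwivediSaxena2022, §3 proof of Thm. 3.2, base case "define U_{i,0} := T_{i,0} and V_{i,0} := P_{i,0} := Q_{i,0} = 1" and "Φ(T_{i,0})|_{x=0} = T_{i,0}(α) ≠ 0" (full version p0028 L748–754)] -/
theorem val_ofLiveTerm {d : ℕ} (α : Fin d → Option (Fin n) → K) (h : LiveTerm α) :
    (ofLiveTerm α h).val =
      algebraMap (MvPolynomial (Fin n) K) (FractionRing (MvPolynomial (Fin n) K))
        (∏ j, affForm (α j)) := by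
  rw [ofLiveTerm, ExactTerm.val_ofForms, C_1, one_mul, formProd_ofFn]

/-- `wf_ofLiveTerm` (API of the DiDIL iteration). [cite: DuttaDwivediSaxena2022, §3 proof of Thm. 3.2, base case "define U_{i,0} := T_{i,0} and V_{i,0} := P_{i,0} := Q_{i,0} = 1" and "Φ(T_{i,0})|_{x=0} = T_{i,0}(α) ≠ 0" (full version p0028 L748–754)] -/
theorem wf_ofLiveTerm {d : ℕ} (α : Fin d → Option (Fin n) → K) (h : LiveTerm α) :
    (ofLiveTerm α h).WF :=
  ExactTerm.wf_ofForms _ _ _ _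

/-- `nd_ofLiveTerm` (API of the DiDIL iteration). [cite: DuttaDwivediSaxena2022, §3 proof of Thm. 3.2, base case "define U_{i,0} := T_{i,0} and V_{i,0} := P_{i,0} := Q_{i,0} = 1" and "Φ(T_{i,0})|_{x=0} = T_{i,0}(α) ≠ 0" (full version p0028 L748–754)] -/
theorem nd_ofLiveTerm {d : ℕ} (α : Fin d → Option (Fin n) → K) (h : LiveTerm α) :
    (ofLiveTerm α h).ND :=
  ExactTerm.nd_ofForms _ _ _ _

/-- `bdd_ofLiveTerm` (API of the DiDIL iteration). [cite: DuttaDwivediSaxena2022, §3 proof of Thm. 3.2, base case "define U_{i,0} := T_{i,0} and V_{i,0} := P_{i,0} := Q_{i,0} = 1" and "Φ(T_{i,0})|_{x=0} = T_{i,0}(α) ≠ 0" (full version p0028 L748–754)] -/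
theorem bdd_ofLiveTerm {d : ℕ} (α : Fin d → Option (Fin n) → K) (h : LiveTerm α) :
    (ofLiveTerm α h).Bdd d := by
  have hb := ExactTerm.bdd_ofForms 1 one_ne_zero (List.ofFn α) (fun a ha => by
    obtain ⟨j, rfl⟩ := List.mem_ofFn.1 ha
    exact h j)
  rw [List.length_ofFn] at hb
  exact hb

/-- `cert_ofLiveTerm` (API of the DiDIL iteration). [cite: DuttaDwivediSaxena2022, §3 proof of Thm. 3.2, base case "define U_{i,0} := T_{i,0} and V_{i,0} := P_{i,0} := Q_{i,0} = 1" and "Φ(T_{i,0})|_{x=0} = T_{i,0}(α) ≠ 0" (full version p0028 L748–754)] -/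
theorem cert_ofLiveTerm {d : ℕ} (α : Fin d → Option (Fin n) → K) (h : LiveTerm α) (N : ℕ) :
    (ofLiveTerm α h).Cert N 1 :=
  ExactTerm.cert_ofForms _ _ _ _ N

/-- **Stage `0` of DiDIL as data**: if every NONZERO form of a `Σ^{[k]}Π^{[d]}Σ` circuit
`Σ_i ∏_j ℓ_{ij}` has a nonzero constant term (the generic-shift hypothesis "`Φ(T_{i,0})|_{x=0} =
T_{i,0}(α) ≠ 0`", full version p0028 L753–754), then its value is the sum of `m ≤ k` well-formed,
nondegenerate exact terms of size `≤ d` with trivial certificates (the live products; products with a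
zero form vanish and are dropped).
[cite: DuttaDwivediSaxena2022, §3 proof of Thm. 3.2, base case "define U_{i,0} := T_{i,0} and V_{i,0} := P_{i,0} := Q_{i,0} = 1" and "Φ(T_{i,0})|_{x=0} = T_{i,0}(α) ≠ 0" (full version p0028 L748–754)] -/
theorem exists_stageZero {k d : ℕ} (α : Fin k → Fin d → Option (Fin n) → K)
    (hα : ∀ i j, affForm (α i j) ≠ 0 → (α i j) none ≠ 0) :
    ∃ (m : ℕ) (G : Fin m → ExactTerm K n), m ≤ k ∧
      (∀ i, (G i).WF ∧ (G i).ND ∧ (G i).Bdd d ∧ ∀ N, (G i).Cert N 1) ∧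
      ∑ i, (G i).val =
        algebraMap (MvPolynomial (Fin n) K) (FractionRing (MvPolynomial (Fin n) K))
          (∑ i, ∏ j, affForm (α i j)) := by
  classical
  set s : Finset (Fin k) := Finset.univ.filter fun i => LiveTerm (α i) with hs
  have hmem : ∀ x : s, LiveTerm (α x) := fun x => (Finset.mem_filter.1 x.2).2
  refine ⟨s.card, fun i => ofLiveTerm (α (s.equivFin.symm i)) (hmem _), ?_, ?_, ?_⟩
  · exact (Finset.card_filter_le _ _).trans (by simp)
  · intro i
    exact ⟨wf_ofLiveTerm _ _, nd_ofLiveTerm _ _, bdd_ofLiveTerm _ _, fun N => cert_ofLiveTerm _ _ N⟩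
  · have h1 : ∑ i : Fin s.card, (ofLiveTerm (α (s.equivFin.symm i)) (hmem _)).val =
        ∑ x : s, (ofLiveTerm (α x) (hmem x)).val :=
      Equiv.sum_comp s.equivFin.symm (fun x : s => (ofLiveTerm (α x) (hmem x)).val)
    rw [h1]
    have h2 : ∑ x : s, (ofLiveTerm (α x) (hmem x)).val =
        ∑ x ∈ s, algebraMap (MvPolynomial (Fin n) K) (FractionRing (MvPolynomial (Fin n) K))
          (∏ j, affForm (α x j)) := by
      rw [← Finset.sum_coe_sort s]
      exact Finset.sum_congr rfl fun x _ => val_ofLiveTerm _ _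
    rw [h2, map_sum, hs, Finset.sum_filter]
    refine Finset.sum_congr rfl fun i _ => ?_
    split_ifs with hi
    · rfl
    · obtain ⟨j, hj⟩ : ∃ j, ¬ (α i j) none ≠ 0 := by
        by_contra hc
        push Not at hc
        exact hi fun j => by simpa using hc j
      have hz : affForm (α i j) = 0 := by
        by_contra hne
        exact hj (hα i j hne)
      rw [Finset.prod_eq_zero (Finset.mem_univ j) hz, map_zero]

/-! ## §8 Provenance of the forms (requested by the end game, val-lit t19 g12)

Every affine form occurring in a DiDIL transcript is one of the ORIGINAL (shifted) input forms:
`divT`, `derT`, `didil` only concatenate the four form lists (`A.num`, `A.den`, `𝒫.L`, `𝒬.L`), so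
any property `P` of forms holding for all forms of the inputs holds for all forms of every later
term ("`U_{i,j+1} := U_{i,j} · V_{k−j,j} / …`": the `ΠΣ` parts are products of the given forms,
full version p0031 L836–845). This is what transports per-form hypotheses (ε-regularity of the
shifted input forms) to the last stage. -/

section Provenance

namespace ExactTerm

/-- "All affine forms of the term `T` (in `A.num`, `A.den`, `𝒫.L`, `𝒬.L`) satisfy `P`."
[cite: DuttaDwivediSaxena2022, §3 proof of Thm. 3.2, "Invertibility of ΠΣ-circuits", `U_{i,j+1} := ε^{-a}·U_{i,j}·V_{k-j,j}`, `V_{i,j+1} := V_{i,j}·U_{k-j,j}` (full version p0031 L836–845)] -/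
def FormsSat (P : (Option (Fin n) → K) → Prop) (T : ExactTerm K n) : Prop :=
  (∀ a ∈ T.A.num, P a) ∧ (∀ a ∈ T.A.den, P a) ∧ (∀ a ∈ T.P.L, P a) ∧ (∀ a ∈ T.Q.L, P a)

/-- `FormsSat` as one statement about the concatenated list of all forms.
[cite: DuttaDwivediSaxena2022, §3 proof of Thm. 3.2, "Invertibility of ΠΣ-circuits" (full version p0031 L836–845)] -/
theorem formsSat_iff_forall_append (P : (Option (Fin n) → K) → Prop) (T : ExactTerm K n) :
    T.FormsSat P ↔ ∀ a ∈ T.A.num ++ T.A.den ++ T.P.L ++ T.Q.L, P a := by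
  simp only [FormsSat, List.mem_append, or_imp, forall_and]
  tauto

/-- `FormsSat` is monotone in the predicate.
[cite: DuttaDwivediSaxena2022, §3 proof of Thm. 3.2, "Invertibility of ΠΣ-circuits" (full version p0031 L836–845)] -/
theorem FormsSat.imp {P P' : (Option (Fin n) → K) → Prop} (h : ∀ a, P a → P' a) {T : ExactTerm K n}
    (hT : T.FormsSat P) : T.FormsSat P' :=
  ⟨fun a ha => h a (hT.1 a ha), fun a ha => h a (hT.2.1 a ha), fun a ha => h a (hT.2.2.1 a ha),
    fun a ha => h a (hT.2.2.2 a ha)⟩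

/-- The forms of `ofForms κ L` are those of `L`.
[cite: DuttaDwivediSaxena2022, §3 proof of Thm. 3.2, the terms `(U/V)·(P/Q)` (full version p0030 L801–805, p0031 L836–845)] -/
theorem formsSat_ofForms {P : (Option (Fin n) → K) → Prop} (κ : K) (hκ : κ ≠ 0)
    (L : List (Option (Fin n) → K)) (hL : ∀ a ∈ L, a none ≠ 0) (hP : ∀ a ∈ L, P a) :
    (ofForms κ hκ L hL).FormsSat P := by
  refine ⟨hP, ?_, ?_, ?_⟩ <;> simp [ofForms, FracPair.ofPoly]

/-- Scalars do not touch the forms.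
[cite: DuttaDwivediSaxena2022, §3 proof of Thm. 3.2, the terms `(U/V)·(P/Q)` (full version p0030 L801–805, p0031 L836–845)] -/
theorem FormsSat.smul {P : (Option (Fin n) → K) → Prop} (c : K) (hc : c ≠ 0) {T : ExactTerm K n}
    (hT : T.FormsSat P) : (T.smul c hc).FormsSat P :=
  hT

/-- The four form lists of `T.divT S`. [cite: DuttaDwivediSaxena2022, §3 proof of Thm. 3.2, "Invertibility of ΠΣ-circuits", `U_{i,j+1}`, `V_{i,j+1}` (full version p0031 L836–845)] -/
theorem divT_A_num (T S : ExactTerm K n) : (T.divT S).A.num = T.A.num ++ S.A.den := rfl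

/-- The four form lists of `T.divT S`. [cite: DuttaDwivediSaxena2022, §3 proof of Thm. 3.2, "Invertibility of ΠΣ-circuits", `U_{i,j+1}`, `V_{i,j+1}` (full version p0031 L836–845)] -/
theorem divT_A_den (T S : ExactTerm K n) : (T.divT S).A.den = T.A.den ++ S.A.num := rfl

/-- The four form lists of `T.divT S`. [cite: DuttaDwivediSaxena2022, §3 proof of Thm. 3.2, "Invertibility of ΠΣ-circuits", `U_{i,j+1}`, `V_{i,j+1}` (full version p0031 L836–845)] -/
theorem divT_P_L (T S : ExactTerm K n) : (T.divT S).P.L = T.P.L ++ S.Q.L := rfl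

/-- The four form lists of `T.divT S`. [cite: DuttaDwivediSaxena2022, §3 proof of Thm. 3.2, "Invertibility of ΠΣ-circuits", `U_{i,j+1}`, `V_{i,j+1}` (full version p0031 L836–845)] -/
theorem divT_Q_L (T S : ExactTerm K n) : (T.divT S).Q.L = T.Q.L ++ S.P.L := rfl

/-- The form lists of `T.derT E₀`: the `ΠΣ` part is unchanged.
[cite: DuttaDwivediSaxena2022, §3 proof of Thm. 3.2, Divide and Derive, eq. (3.2) (full version p0030 L808–812, p0031 L815–817)] -/
theorem derT_A (E₀ : Derivation K (MvPolynomial (Fin n) K) (MvPolynomial (Fin n) K))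
    (T : ExactTerm K n) : (T.derT E₀).A = T.A := rfl

/-- The form lists of `T.derT E₀`: the new `𝒫`-list repeats the old lists.
[cite: DuttaDwivediSaxena2022, §3 proof of Thm. 3.2, Divide and Derive, eq. (3.2) (full version p0030 L808–812, p0031 L815–817)] -/
theorem derT_P_L (E₀ : Derivation K (MvPolynomial (Fin n) K) (MvPolynomial (Fin n) K))
    (T : ExactTerm K n) :
    (T.derT E₀).P.L = T.A.num ++ T.A.den ++ (T.P.L ++ T.Q.L) ++
      (T.P.L ++ T.P.L ++ T.Q.L ++ (T.P.L ++ (T.Q.L ++ T.Q.L))) := rfl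

/-- The form lists of `T.derT E₀`: the new `𝒬`-list is the old one twice.
[cite: DuttaDwivediSaxena2022, §3 proof of Thm. 3.2, Divide and Derive, eq. (3.2) (full version p0030 L808–812, p0031 L815–817)] -/
theorem derT_Q_L (E₀ : Derivation K (MvPolynomial (Fin n) K) (MvPolynomial (Fin n) K))
    (T : ExactTerm K n) : (T.derT E₀).Q.L = T.Q.L ++ T.Q.L := rfl

/-- **Closure under `divT`**: the forms of `T.divT S` are forms of `T` or of `S`.
[cite: DuttaDwivediSaxena2022, §3 proof of Thm. 3.2, "Invertibility of ΠΣ-circuits", `U_{i,j+1}`, `V_{i,j+1}` (full version p0031 L836–845)] -/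
theorem FormsSat.divT {P : (Option (Fin n) → K) → Prop} {T S : ExactTerm K n} (hT : T.FormsSat P)
    (hS : S.FormsSat P) : (T.divT S).FormsSat P := by
  obtain ⟨hTn, hTd, hTP, hTQ⟩ := hT
  obtain ⟨hSn, hSd, hSP, hSQ⟩ := hS
  refine ⟨fun a ha => ?_, fun a ha => ?_, fun a ha => ?_, fun a ha => ?_⟩
  · rw [divT_A_num, List.mem_append] at ha
    exact ha.elim (hTn a) (hSd a)
  · rw [divT_A_den, List.mem_append] at ha
    exact ha.elim (hTd a) (hSn a)
  · rw [divT_P_L, List.mem_append] at ha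
    exact ha.elim (hTP a) (hSQ a)
  · rw [divT_Q_L, List.mem_append] at ha
    exact ha.elim (hTQ a) (hSP a)

/-- **Closure under `derT`**: differentiating only repeats the form lists.
[cite: DuttaDwivediSaxena2022, §3 proof of Thm. 3.2, Divide and Derive, eq. (3.2) (full version p0030 L808–812, p0031 L815–817)] -/
theorem FormsSat.derT {P : (Option (Fin n) → K) → Prop}
    (E₀ : Derivation K (MvPolynomial (Fin n) K) (MvPolynomial (Fin n) K)) {T : ExactTerm K n}
    (hT : T.FormsSat P) : (T.derT E₀).FormsSat P := by
  obtain ⟨hTn, hTd, hTP, hTQ⟩ := hT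
  refine ⟨fun a ha => ?_, fun a ha => ?_, fun a ha => ?_, fun a ha => ?_⟩
  · rw [derT_A] at ha
    exact hTn a ha
  · rw [derT_A] at ha
    exact hTd a ha
  · simp only [derT_P_L, List.mem_append] at ha
    rcases ha with ((ha | ha) | (ha | ha)) | (((ha | ha) | ha) | (ha | (ha | ha)))
    all_goals first | exact hTn a ha | exact hTd a ha | exact hTP a ha | exact hTQ a ha
  · rw [derT_Q_L, List.mem_append] at ha
    exact ha.elim (hTQ a) (hTQ a)

/-- **Closure under one DiDIL operation** `didil E₀ T S = (T.divT S).derT E₀`.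
[cite: DuttaDwivediSaxena2022, §3 proof of Thm. 3.2, Divide and Derive, eq. (3.2) (full version p0030 L808–812, p0031 L815–817)] -/
theorem FormsSat.didil {P : (Option (Fin n) → K) → Prop}
    (E₀ : Derivation K (MvPolynomial (Fin n) K) (MvPolynomial (Fin n) K)) {T S : ExactTerm K n}
    (hT : T.FormsSat P) (hS : S.FormsSat P) : (didil E₀ T S).FormsSat P :=
  (hT.divT hS).derT E₀

end ExactTerm

/-- **Closure under one DiDIL step** on a family.
[cite: DuttaDwivediSaxena2022, §3 proof of Thm. 3.2, Divide and Derive, eq. (3.2) (full version p0030 L808–812, p0031 L815–817)] -/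
theorem formsSat_didilStep {P : (Option (Fin n) → K) → Prop}
    (E₀ : Derivation K (MvPolynomial (Fin n) K) (MvPolynomial (Fin n) K)) {m : ℕ}
    {G : Fin (m + 1) → ExactTerm K n} (hG : ∀ i, (G i).FormsSat P) (i₀ : Fin (m + 1)) (i : Fin m) :
    (didilStep E₀ G i₀ i).FormsSat P :=
  (hG _).didil E₀ (hG _)

/-- **Closure under the DiDIL iteration** (induction on the number of rounds, as `wf_didilIter`).
[cite: DuttaDwivediSaxena2022, §3 proof of Thm. 3.2, the DiDIL induction over j = 0, …, k−1 (full version p0030 L799–812)] -/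
theorem formsSat_didilIter {P : (Option (Fin n) → K) → Prop}
    (E₀ : Derivation K (MvPolynomial (Fin n) K) (MvPolynomial (Fin n) K)) (c : Choice K n) (m : ℕ) :
    ∀ (j : ℕ) (G : Fin (m + j) → ExactTerm K n), (∀ i, (G i).FormsSat P) →
      ∀ i, (didilIter E₀ c m j G i).FormsSat P
  | 0, _, hG => hG
  | j + 1, G, hG => by
    rw [didilIter_succ]
    exact formsSat_didilIter E₀ c m j _ (fun i => formsSat_didilStep E₀ hG _ i)

/-- The forms of a live stage-`0` term `ofLiveTerm α` are the `α j`.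
[cite: DuttaDwivediSaxena2022, §3 proof of Thm. 3.2, base case (full version p0028 L748–754)] -/
theorem formsSat_ofLiveTerm {P : (Option (Fin n) → K) → Prop} {d : ℕ}
    (α : Fin d → Option (Fin n) → K) (h : LiveTerm α) (hα : ∀ j, P (α j)) :
    (ofLiveTerm α h).FormsSat P :=
  ExactTerm.formsSat_ofForms _ _ _ _ fun a ha => by
    obtain ⟨j, rfl⟩ := List.mem_ofFn.1 ha
    exact hα j

/-- **Stage `0` with provenance**: `exists_stageZero` together with the record that every form of
every term `G i` IS one of the input forms `α i' j` (so any per-form hypothesis on the inputs —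
e.g. ε-regularity of the shifted forms — transports to the whole transcript via
`formsSat_didilIter` and `FormsSat.imp`).
[cite: DuttaDwivediSaxena2022, §3 proof of Thm. 3.2, base case "define U_{i,0} := T_{i,0} and V_{i,0} := P_{i,0} := Q_{i,0} = 1" and "Φ(T_{i,0})|_{x=0} = T_{i,0}(α) ≠ 0" (full version p0028 L748–754)] -/
theorem exists_stageZero_forall {k d : ℕ} (α : Fin k → Fin d → Option (Fin n) → K)
    (hα : ∀ i j, affForm (α i j) ≠ 0 → (α i j) none ≠ 0) :
    ∃ (m : ℕ) (G : Fin m → ExactTerm K n), m ≤ k ∧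
      (∀ i, (G i).WF ∧ (G i).ND ∧ (G i).Bdd d ∧ ∀ N, (G i).Cert N 1) ∧
      (∀ i, (G i).FormsSat fun a => ∃ i' j, a = α i' j) ∧
      ∑ i, (G i).val =
        algebraMap (MvPolynomial (Fin n) K) (FractionRing (MvPolynomial (Fin n) K))
          (∑ i, ∏ j, affForm (α i j)) := by
  classical
  set s : Finset (Fin k) := Finset.univ.filter fun i => LiveTerm (α i) with hs
  have hmem : ∀ x : s, LiveTerm (α x) := fun x => (Finset.mem_filter.1 x.2).2
  refine ⟨s.card, fun i => ofLiveTerm (α (s.equivFin.symm i)) (hmem _), ?_, ?_, ?_, ?_⟩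
  · exact (Finset.card_filter_le _ _).trans (by simp)
  · intro i
    exact ⟨wf_ofLiveTerm _ _, nd_ofLiveTerm _ _, bdd_ofLiveTerm _ _, fun N => cert_ofLiveTerm _ _ N⟩
  · intro i
    exact formsSat_ofLiveTerm _ _ fun j => ⟨_, j, rfl⟩
  · have h1 : ∑ i : Fin s.card, (ofLiveTerm (α (s.equivFin.symm i)) (hmem _)).val =
        ∑ x : s, (ofLiveTerm (α x) (hmem x)).val :=
      Equiv.sum_comp s.equivFin.symm (fun x : s => (ofLiveTerm (α x) (hmem x)).val)
    rw [h1]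
    have h2 : ∑ x : s, (ofLiveTerm (α x) (hmem x)).val =
        ∑ x ∈ s, algebraMap (MvPolynomial (Fin n) K) (FractionRing (MvPolynomial (Fin n) K))
          (∏ j, affForm (α x j)) := by
      rw [← Finset.sum_coe_sort s]
      exact Finset.sum_congr rfl fun x _ => val_ofLiveTerm _ _
    rw [h2, map_sum, hs, Finset.sum_filter]
    refine Finset.sum_congr rfl fun i _ => ?_
    split_ifs with hi
    · rfl
    · obtain ⟨j, hj⟩ : ∃ j, ¬ (α i j) none ≠ 0 := by
        by_contra hc
        push Not at hc
        exact hi fun j => by simpa using hc j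
      have hz : affForm (α i j) = 0 := by
        by_contra hne
        exact hj (hα i j hne)
      rw [Finset.prod_eq_zero (Finset.mem_univ j) hz, map_zero]

/-- **Stage `0` with provenance AND shape** (asked by the E4.4 companion, val-lit t21 g13):
`exists_stageZero_forall` together with the record that every term `G i` IS a live input product
`ofLiveTerm (α i') h` (so `𝒫 = 𝒬 = 1`, `A.den = []`, "`P_{i,0} := Q_{i,0} = 1`", p0028 L748–750).
[cite: DuttaDwivediSaxena2022, §3 proof of Thm. 3.2, base case "define U_{i,0} := T_{i,0} and V_{i,0} := P_{i,0} := Q_{i,0} = 1" (full version p0028 L748–754)] -/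
theorem exists_stageZero_ofLiveTerm {k d : ℕ} (α : Fin k → Fin d → Option (Fin n) → K)
    (hα : ∀ i j, affForm (α i j) ≠ 0 → (α i j) none ≠ 0) :
    ∃ (m : ℕ) (G : Fin m → ExactTerm K n), m ≤ k ∧
      (∀ i, (G i).WF ∧ (G i).ND ∧ (G i).Bdd d ∧ ∀ N, (G i).Cert N 1) ∧
      (∀ i, (G i).FormsSat fun a => ∃ i' j, a = α i' j) ∧
      (∀ i, ∃ (i' : Fin k) (h : LiveTerm (α i')), G i = ofLiveTerm (α i') h) ∧
      ∑ i, (G i).val =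
        algebraMap (MvPolynomial (Fin n) K) (FractionRing (MvPolynomial (Fin n) K))
          (∑ i, ∏ j, affForm (α i j)) := by
  classical
  set s : Finset (Fin k) := Finset.univ.filter fun i => LiveTerm (α i) with hs
  have hmem : ∀ x : s, LiveTerm (α x) := fun x => (Finset.mem_filter.1 x.2).2
  refine ⟨s.card, fun i => ofLiveTerm (α (s.equivFin.symm i)) (hmem _), ?_, ?_, ?_, ?_, ?_⟩
  · exact (Finset.card_filter_le _ _).trans (by simp)
  · intro i
    exact ⟨wf_ofLiveTerm _ _, nd_ofLiveTerm _ _, bdd_ofLiveTerm _ _, fun N => cert_ofLiveTerm _ _ N⟩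
  · intro i
    exact formsSat_ofLiveTerm _ _ fun j => ⟨_, j, rfl⟩
  · intro i
    exact ⟨_, hmem _, rfl⟩
  · have h1 : ∑ i : Fin s.card, (ofLiveTerm (α (s.equivFin.symm i)) (hmem _)).val =
        ∑ x : s, (ofLiveTerm (α x) (hmem x)).val :=
      Equiv.sum_comp s.equivFin.symm (fun x : s => (ofLiveTerm (α x) (hmem x)).val)
    rw [h1]
    have h2 : ∑ x : s, (ofLiveTerm (α x) (hmem x)).val =
        ∑ x ∈ s, algebraMap (MvPolynomial (Fin n) K) (FractionRing (MvPolynomial (Fin n) K))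
          (∏ j, affForm (α x j)) := by
      rw [← Finset.sum_coe_sort s]
      exact Finset.sum_congr rfl fun x _ => val_ofLiveTerm _ _
    rw [h2, map_sum, hs, Finset.sum_filter]
    refine Finset.sum_congr rfl fun i _ => ?_
    split_ifs with hi
    · rfl
    · obtain ⟨j, hj⟩ : ∃ j, ¬ (α i j) none ≠ 0 := by
        by_contra hc
        push Not at hc
        exact hi fun j => by simpa using hc j
      have hz : affForm (α i j) = 0 := by
        by_contra hne
        exact hj (hα i j hne)
      rw [Finset.prod_eq_zero (Finset.mem_univ j) hz, map_zero]

end Provenance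

/-! ## §9 The uniform-`𝒬` invariant (v5; asked via RULING (167)(a)(1) for the slice-zero programs)

All terms of a DiDIL stage share ONE `𝒬`-fraction (as records, literally): at stage `0` it is
`ofPoly 1` ("`Q_{i,0} = 1`", p0028 L748–750), and `didilStep` replaces each `𝒬_i` by
`(𝒬_i · 𝒫_{i₀}) · (𝒬_i · 𝒫_{i₀})`, which does not depend on `i` once the `𝒬_i` agree. -/

section UniformQ

namespace ExactTerm

/-- `divT_Q` (record accessor). [cite: DuttaDwivediSaxena2022, §3 proof of Thm. 3.2, Divide and Derive (full version p0030 L808–812, p0031 L815–817)] -/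
theorem divT_Q (T S : ExactTerm K n) : (T.divT S).Q = T.Q.mul S.P := rfl

/-- `divT_P` (record accessor). [cite: DuttaDwivediSaxena2022, §3 proof of Thm. 3.2, Divide and Derive (full version p0030 L808–812, p0031 L815–817)] -/
theorem divT_P (T S : ExactTerm K n) : (T.divT S).P = T.P.mul S.Q := rfl

/-- `derT_Q` (record accessor). [cite: DuttaDwivediSaxena2022, §3 proof of Thm. 3.2, Divide and Derive (full version p0030 L808–812, p0031 L815–817)] -/
theorem derT_Q (E₀ : Derivation K (MvPolynomial (Fin n) K) (MvPolynomial (Fin n) K))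
    (T : ExactTerm K n) : (T.derT E₀).Q = T.Q.mul T.Q := rfl

/-- `didil_Q` (record accessor). [cite: DuttaDwivediSaxena2022, §3 proof of Thm. 3.2, Divide and Derive (full version p0030 L808–812, p0031 L815–817)] -/
theorem didil_Q (E₀ : Derivation K (MvPolynomial (Fin n) K) (MvPolynomial (Fin n) K))
    (T S : ExactTerm K n) : (didil E₀ T S).Q = (T.Q.mul S.P).mul (T.Q.mul S.P) := rfl

/-- `ofForms_P` (record accessor): `𝒫 = 1` for a bare `ΠΣ` product. [cite: DuttaDwivediSaxena2022, §3 proof of Thm. 3.2, base case "P_{i,0} := Q_{i,0} = 1" (full version p0028 L748–750)] -/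
theorem ofForms_P (κ : K) (hκ : κ ≠ 0) (L : List (Option (Fin n) → K)) (hL : ∀ a ∈ L, a none ≠ 0) :
    (ofForms κ hκ L hL).P = FracPair.ofPoly 1 := rfl

/-- `ofForms_Q` (record accessor): `𝒬 = 1` for a bare `ΠΣ` product. [cite: DuttaDwivediSaxena2022, §3 proof of Thm. 3.2, base case "P_{i,0} := Q_{i,0} = 1" (full version p0028 L748–750)] -/
theorem ofForms_Q (κ : K) (hκ : κ ≠ 0) (L : List (Option (Fin n) → K)) (hL : ∀ a ∈ L, a none ≠ 0) :
    (ofForms κ hκ L hL).Q = FracPair.ofPoly 1 := rfl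

end ExactTerm

/-- `didilStep_Q` (record accessor): the new `𝒬` of the `i`-th term.
[cite: DuttaDwivediSaxena2022, §3 proof of Thm. 3.2, Divide and Derive (full version p0030 L808–812, p0031 L815–817)] -/
theorem didilStep_Q (E₀ : Derivation K (MvPolynomial (Fin n) K) (MvPolynomial (Fin n) K)) {m : ℕ}
    (G : Fin (m + 1) → ExactTerm K n) (i₀ : Fin (m + 1)) (i : Fin m) :
    (didilStep E₀ G i₀ i).Q =
      ((G (i₀.succAbove i)).Q.mul (G i₀).P).mul ((G (i₀.succAbove i)).Q.mul (G i₀).P) := rfl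

/-- **The uniform-`𝒬` invariant, one step**: if all `𝒬_i` agree, so do all `𝒬`'s after a DiDIL
step. [cite: DuttaDwivediSaxena2022, §3 proof of Thm. 3.2, Divide and Derive with "Q_{i,0} = 1" (full version p0028 L748–750, p0030 L808–812)] -/
theorem didilStep_Q_eq (E₀ : Derivation K (MvPolynomial (Fin n) K) (MvPolynomial (Fin n) K)) {m : ℕ}
    (G : Fin (m + 1) → ExactTerm K n) (i₀ : Fin (m + 1)) (hG : ∀ i i', (G i).Q = (G i').Q)
    (i i' : Fin m) : (didilStep E₀ G i₀ i).Q = (didilStep E₀ G i₀ i').Q := by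
  rw [didilStep_Q, didilStep_Q, hG (i₀.succAbove i) (i₀.succAbove i')]

/-- **The uniform-`𝒬` invariant along the iteration.**
[cite: DuttaDwivediSaxena2022, §3 proof of Thm. 3.2, the DiDIL induction (full version p0030 L799–812)] -/
theorem didilIter_Q_eq (E₀ : Derivation K (MvPolynomial (Fin n) K) (MvPolynomial (Fin n) K))
    (c : Choice K n) (m : ℕ) :
    ∀ (j : ℕ) (G : Fin (m + j) → ExactTerm K n), (∀ i i', (G i).Q = (G i').Q) →
      ∀ i i', (didilIter E₀ c m j G i).Q = (didilIter E₀ c m j G i').Q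
  | 0, _, hG => hG
  | j + 1, G, hG => by
    rw [didilIter_succ]
    exact didilIter_Q_eq E₀ c m j _ (didilStep_Q_eq E₀ G _ hG)

/-- `ofLiveTerm_P`: `𝒫 = 1` at stage `0`. [cite: DuttaDwivediSaxena2022, §3 proof of Thm. 3.2, base case "P_{i,0} := Q_{i,0} = 1" (full version p0028 L748–750)] -/
theorem ofLiveTerm_P {d : ℕ} (α : Fin d → Option (Fin n) → K) (h : LiveTerm α) :
    (ofLiveTerm α h).P = FracPair.ofPoly 1 := rfl

/-- `ofLiveTerm_Q`: `𝒬 = 1` at stage `0`. [cite: DuttaDwivediSaxena2022, §3 proof of Thm. 3.2, base case "P_{i,0} := Q_{i,0} = 1" (full version p0028 L748–750)] -/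
theorem ofLiveTerm_Q {d : ℕ} (α : Fin d → Option (Fin n) → K) (h : LiveTerm α) :
    (ofLiveTerm α h).Q = FracPair.ofPoly 1 := rfl

/-- **The run version from stage `0`**: a family of live stage-`0` terms (the shape clause of
`exists_stageZero_ofLiveTerm`) has uniform `𝒬 = 1`, hence every later stage has a uniform `𝒬`.
[cite: DuttaDwivediSaxena2022, §3 proof of Thm. 3.2, base case and the DiDIL induction (full version p0028 L748–750, p0030 L799–812)] -/
theorem Q_eq_of_ofLiveTerm {k d m : ℕ} {α : Fin k → Fin d → Option (Fin n) → K}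
    {G : Fin m → ExactTerm K n} (hG : ∀ i, ∃ (i' : Fin k) (h : LiveTerm (α i')), G i = ofLiveTerm (α i') h)
    (i i' : Fin m) : (G i).Q = (G i').Q := by
  obtain ⟨a, ha, ea⟩ := hG i
  obtain ⟨b, hb, eb⟩ := hG i'
  rw [ea, eb, ofLiveTerm_Q, ofLiveTerm_Q]

/-- Uniform `𝒬` after `j` rounds from a live stage `0`.
[cite: DuttaDwivediSaxena2022, §3 proof of Thm. 3.2, base case and the DiDIL induction (full version p0028 L748–750, p0030 L799–812)] -/
theorem didilIter_Q_eq_of_ofLiveTerm (E₀ : Derivation K (MvPolynomial (Fin n) K) (MvPolynomial (Fin n) K))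
    (c : Choice K n) {k d m j : ℕ} {α : Fin k → Fin d → Option (Fin n) → K}
    {G : Fin (m + j) → ExactTerm K n}
    (hG : ∀ i, ∃ (i' : Fin k) (h : LiveTerm (α i')), G i = ofLiveTerm (α i') h) (i i' : Fin m) :
    (didilIter E₀ c m j G i).Q = (didilIter E₀ c m j G i').Q :=
  didilIter_Q_eq E₀ c m j G (Q_eq_of_ofLiveTerm hG) i i'

end UniformQ

end DDS2021

end Literature.Computability.AlgebraicComplexity

end
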